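import Literature.MathematicalPhysics.QuantumFieldTheory.Balaban1983to89.T4LambdaMatching

/-!
# `Balaban1983to89.T4ScaleMatchingRate` — NE4 (node U2): THE SCALE-BY-SCALE LATTICE-TO-CONTINUUM MATCHING OF THE
# RUNNING COUPLING AT EVERY ULTRAVIOLET INDEX, WITHOUT THE TWO-LOOP SPLIT, AND WITH A RATE —
# `1/g_{j+m}(j)² − a⋆_m → δ_j := Σ_i (β⁰_{j+i} − β⁰_∞)`, `= δ_j + O(log m/√m)`, and the two-trajectory scale step
# `1/g_{j+m+1}(j)² − 1/g_{j+m}(j)² = β⁰_∞ + O(log m/√m)`, with ONE constant for every pinned family, pin and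
# ultraviolet index (v1.1) — under the named binders of `T4ContinuumCoupling` plus (AF-0r) in rate form and (AF-1)

Cell `pub-balaban`, T⁴ programme (T4-DAG node U2, spine estimate NE4 = the η-rate of the FULL β-functions, booked as
β¹-half + β⁰-half; unit `b2b-balaban-t4-ne4-p2`, technique P2 "two-trajectory comparison at spacings ε vs ε/L: match
couplings scale by scale using the β-pert cell's (AF-0r) rate as input hypothesis and bound the β¹ mismatch",
generation 10, sixth node; journal row T4-U2.NE4-PROVE-P2j*; v1.1 = row T4-U2.NE4-PROVE-P2j2*, the UNIFORMITY
addendum: same imports, every v1 statement unchanged, four theorems added).  Companion record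
`run/shared/lean/pub/pub-balaban/t4/T4-EST-NE4-P2.md` v1.17 §23 (v1) and v1.18 §24 (v1.1).  Sequel of
`T4LambdaMatching` (row P2i5*, gen 9: the
bare-to-continuum matching `1/g_K(0)² − a⋆_K → δ₀` as a PURE LIMIT under the two-loop split (TL)), which it sharpens
three ways: EVERY ultraviolet index `j` (not only the bare end), NO binder (TL) (nor `C₃, c₁, θ₁, β¹¹_∞`), and a RATE.

NEW module of unit `b2b-balaban-t4-ne4-p2` generation 10; imports `T4LambdaMatching` (this lineage, gen 9, v1) only
and modifies nothing; every object of another lineage (`B12Beta.OneLoopSplit`, `FlowStep.*`, `T4CouplingMatching.*`,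
`T4CauchySum.InjectedRate`) and of this lineage's earlier nodes (`T4ContinuumCoupling.*`, `T4OneLoopAsymptotics.*`,
`T4ContinuumTwoLoopLaw.*`, `T4LambdaMatching.*`) is used BY NAME.

WHAT IS PROVED (kernel; every β-side input a NAMED BINDER, see BINDERS).  Setting as in `T4LambdaMatching`: a family
`g : ℕ → ℕ → ℝ` of solutions of the recursion (0.20) `1/g_K(k+1)² = 1/g_K(k)² − β_{k+1}(g_K(0),…,g_K(k))` in the box
]0,γ], run `K` of length `K`, all PINNED at the infrared end `g_K(K) = g_IR`, with node U2's output shape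
`InjectedRate C 0 θ (disc (g K) (g (K+1)))`, `θ < 1` (so that the continuum inverse running coupling
`a⋆_m = lim_n 1/g_{n+m}(n)²` of `T4ContinuumCoupling` exists; `b⋆_m = a⋆_{m+1} − a⋆_m`, `g⋆_m = (a⋆_m)^{−1/2}`;
`invSq g m j = 1/g_{j+m}(j)²` is the recursion variable of the run with `j + m` steps at ultraviolet index `j`, i.e.
`m` scales above the pin).
* §1 (elementary) geometric series tails `abs_tsum_nat_add_le_geom`, `sum_Ico_mul_pow_le`; `injectedRate_max_zero`: an
  injected rate with exponent `c = 0` may be taken with the ratio `max θ 0` (no sign hypothesis on `θ` is ever needed).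
* §2 THE SCALE DEFECT `W_K(i) := β¹_i(g_K(0..i)) − (b⋆_{K−1−i} − β⁰_∞)` (`scaleDefect`): the β¹-value on the lattice
  trajectory at index `i` minus the β¹-value of the continuum trajectory at the same distance from the pin.  Gen 9's
  two-loop-renormalised defect `T4LambdaMatching.runDefect` IS `W_K(i)` for every value of the two-loop coefficient
  (`runDefect_eq_scaleDefect` = `T4LambdaMatching.runDefect_eq`: the renormalisation cancels identically);
  `β_i(g_K(0..i)) − b⋆_{K−1−i} = (β⁰_i − β⁰_∞) + W_K(i)` (`beta_sub_bstar_eq`); THE BOOKKEEPING IDENTITY AT INDEX `j`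
  `1/g_{j+m}(j)² − a⋆_m = Σ_{l<m}(β⁰_{j+l} − β⁰_∞) + Σ_{l<m} W_{j+m}(j+l)` (`invSq_sub_astar_eq`).
* §3 TWO BOUNDS.  GEOMETRIC, for ALL `i < K`, UNIFORM IN THE RUN: `|W_K(i)| ≤ Cθ^i/(1−θ) + Cθ^{i+1}/(1−θ) + c₀θ₀^i`
  (`abs_scaleDefect_le_geom`) — nothing but node U2's diagonal rate `T4ContinuumCoupling.abs_beta_diag_sub_bstar_le`
  (gen 3) and (AF-0r).  THE ONE OBSERVATION OF THE FILE: this is a majorant of the scale defects SUMMABLE IN THE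
  ULTRAVIOLET INDEX UNIFORMLY IN `K`; gen 9's header sentence "no indexing of the range `j < K` admits a `K`-uniform
  summable majorant" holds for the two-sided bound `T4LambdaMatching.abs_runDefect_le` it proves (whose (TL)-tail is
  geometric in `j` and whose profile tail decays in `K−j`), NOT for the defect itself — the moving split, the separate
  infrared half and the binder (TL) of gen 9 are unnecessary for the matching.  PROFILE, for `k₀ ≤ i < K`:
  `|W_K(i)| ≤ C₁/√(b(K−i)) + C₁(1/g_IR² + b(K−i))^{−1/2} ≤ 2C₁/√(b(K−i))` (`abs_scaleDefect_le_prof`,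
  `abs_scaleDefect_le_two_div_sqrt`: (AF-1) with the asymptotic-freedom profiles `T4OneLoopAsymptotics.run_le_inv_sqrt`
  on the lattice side and `T4ContinuumCoupling.abs_bstar_sub_binf_le` + `gstar_le_inv_sprof` on the continuum side).
* §4 LIMITS.  `tendsto_bstar`: `b⋆_m → β⁰_∞`; `tendsto_scaleDefect`: `W_{j+m}(j+l) → 0` as `m → ∞` for all `j, l`
  ((AF-1) and `g_{j+m}(j+l) → 0`, `T4LambdaMatching.tendsto_run_zero`, valid also below `k₀`);
  `tendsto_sum_scaleDefect_zero`: `Σ_{l<m} W_{j+m}(j+l) → 0` by ONE passage of Tannery's theorem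
  (`T4LambdaMatching.tendsto_sum_range_of_dominated`) on the geometric majorant; the one-loop ultraviolet defect from
  index `j` on, `δ_j := Σ_i (β⁰_{j+i} − β⁰_∞)` (`uvDefect`; `δ_0 = T4LambdaMatching.oneLoopDefect`, `uvDefect_zero`;
  `δ₀ = Σ_{i<j}(β⁰_i − β⁰_∞) + δ_j`, `sum_range_add_uvDefect`; tails `abs_sum_range_sub_uvDefect_le`, `abs_uvDefect_le`:
  `|δ_j| ≤ c₀θ₀^j/(1−θ₀)`).  **THE MATCHING AT EVERY ULTRAVIOLET INDEX** `tendsto_invSq_sub_astar`: for EVERY `j`,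
  **`1/g_{j+m}(j)² − a⋆_m → δ_j`** as `m → ∞` — `j` steps below the bare end the lattice recursion variable and the
  continuum one at the same distance from the pin differ in the limit by the one-loop ultraviolet defect from index `j`
  on, and by nothing else; `tendsto_bare_sub_astar`: the bare end `j = 0`, i.e. gen 9's `tendsto_invSq_bare_sub_astar`
  with the binders (TL), `C₃`, `c₁`, `θ₁`, `β¹¹_∞` DELETED; `abs_uvDefect_le_injected`: `|δ_j| ≤ Cθ^j/(1−θ)` (node U2's
  `K`-uniform tail `T4ContinuumCoupling.abs_invSq_sub_astar_le` in the limit — a consistency condition between the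
  (AF-0r) data and the injected rate); **THE TWO-TRAJECTORY SCALE STEP** `tendsto_twoRun_step`: for EVERY `j`,
  **`1/g_{j+m+1}(j)² − 1/g_{j+m}(j)² → β⁰_∞`** — the couplings of the two pinned lattice trajectories with `K+1` and `K`
  steps (spacings `ε/L` and `ε` below the same unit scale, the same infrared datum), compared AT THE SAME SCALE `j`,
  differ by one continuum scale step in the limit.
* §5 RATES (`k₀ ≤ j`).  `abs_invSq_sub_astar_sub_uvDefect_le` (`0 ≤ θ`): for every cut `J ≤ m`,
  `|1/g_{j+m}(j)² − a⋆_m − δ_j| ≤ 2C₁J/√(b(m+1−J)) + C(1+θ)θ^{j+J}/(1−θ)² + c₀(θ₀^{j+J} + θ₀^{j+m})/(1−θ₀)` — the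
  first `J` offsets (far from the pin) paid with the PROFILE bound, the rest with the GEOMETRIC one; the constants do
  not involve `γ`, `g_IR` or `j`.  With `J = ⌈log m/log(1/ρ)⌉`, `ρ = max(θ, θ₀, 1/2)`:
  **`1/g_{j+m}(j)² − a⋆_m − δ_j = O(log m/√m)`** (`isBigO_invSq_sub_astar_sub_uvDefect`; bare end with `BetaLowerH`,
  `isBigO_bare_sub_astar_sub_oneLoopDefect`: `1/g_K(0)² − a⋆_K − δ₀ = O(log K/√K)` — a RATE for the `O(1)`-matching that
  gen 9 had as a pure limit); `isBigO_bstar_sub`: `b⋆_m − β⁰_∞ = O(log m/√m)` (indeed `≤ C₁/√(bm)`); and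
  **`1/g_{j+m+1}(j)² − 1/g_{j+m}(j)² − β⁰_∞ = O(log m/√m)`** (`isBigO_twoRun_step`, via `log_succ_div_sqrt_le`).  The rate is
  that of the profile piece `(AF-1)·g = O((distance to the pin)^{−1/2})` summed over `O(log m)` ultraviolet offsets; it
  is NOT claimed optimal.  **UNIFORMITY (v1.1)** — the order of the quantifiers made explicit: ONE constant, chosen from
  `(C, θ, b, C₁, c₀, θ₀)` BEFORE the family, serves every pinned family of box runs, every pin `g_IR`, every
  ultraviolet index `j ≥ k₀` and every distance `m ≥ 2`: `abs_invSq_sub_astar_sub_uvDefect_le_unif`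
  **`∃ A ≥ 0, ∀ (family, pin, binders), ∀ j ≥ k₀, ∀ m ≥ 2, |1/g_{j+m}(j)² − a⋆_m − δ_j| ≤ A·log m/√m`**; reindexed to
  whole runs, `abs_run_sub_astar_sub_uvDefect_le_unif`: **`|1/g_K(i)² − a⋆_{K−i} − δ_i| ≤ A·log(K−i)/√(K−i)`** for all
  `k₀ ≤ i ≤ K − 2` — every lattice trajectory tracks the `δ`-shifted continuum trajectory with an error depending only
  on the distance to the pin; `abs_bstar_sub_binf_le_inv_sqrt`: `|b⋆_m − β⁰_∞| ≤ C₁/(√b·√m)` (`m ≥ 1`); and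
  `abs_twoRun_step_sub_le_unif`: **`∃ A′ ≥ 0, ∀ (family, pin, binders), ∀ j ≥ k₀, ∀ m ≥ 2,
  |1/g_{j+m+1}(j)² − 1/g_{j+m}(j)² − β⁰_∞| ≤ A′·log m/√m`**.  (`isBigO_invSq_sub_astar_sub_uvDefect` and `isBigO_bstar_sub`
  are now one-line corollaries; their statements are unchanged.)
* §6 SANITY `example` (non-vacuity of the whole binder list): for the two-loop MARKOV family `β = b + c·p_k²` (`b > 0`,
  `c ≥ 0`, `2cγ(γ³ + 2γ/b) < 1/2`; `T4ContinuumTwoLoopLaw.backwardWP_twoLoopMarkov`, `pinnedRun`,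
  `injectedRate_pinnedRun`) every binder holds for the pinned family of every datum `g_IR ∈ ]0,γ]` with `c₀ = 0`,
  `C₁ = cγ`, `k₀ = 0`, `InjectedRate 0 0 0`; the defects `δ_j` vanish, `1/g_{j+m}(j)² − a⋆_m → 0` at rate
  `O(log m/√m)`, and the two-trajectory scale step tends to `b`, at every `j`; second `example` (v1.1): ONE constant
  `A` with `|1/g_{j+m}(j)² − a⋆_m| ≤ A·log m/√m` for EVERY datum `g_IR ∈ ]0,γ]`, every `j` and every `m ≥ 2`.

BINDERS (hypotheses of the theorems; NONE is a printed theorem for Bałaban's β-functions — each is an OPEN input of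
the β-cell or of node U2, consumed BY NAME and never discharged here): the run-wise recursion (0.20) `RGEqH`, the box
`0 < g_K(i) ≤ γ`, the pin `g_K(K) = g_IR`; `EventualLowerH b γ k₀ β` with `b > 0` (GAPS G-t4-U2-1;
[Balaban1989LargeFieldII] p.355: the β-paper "has not been published yet") — `BetaLowerH` (= `k₀ = 0`) in
`isBigO_bare_sub_astar_sub_oneLoopDefect` only; node U2's OUTPUT SHAPE `InjectedRate C 0 θ`, `θ < 1` (GAPS G-t4-U2-2 —
for history-dependent β this is the estimate NE4 itself; the wall (M) of the record §4/§9/§12 — the two-history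
Lipschitz modulus of β, not printed — is untouched: this file CONSUMES the injected rate, it does not produce it); the
printed SPLIT SHAPE `B12Beta.OneLoopSplit β` ([Balaban1987RG1] (2.12)–(2.14) p.268: β = β⁰ + β¹, β¹ vanishing at zero
history) with the UNPRINTED analytic inputs (AF-0r) IN RATE FORM `|β⁰_k − β⁰_∞| ≤ c₀θ₀^k`, `0 ≤ θ₀ < 1` (MISSING-B12
(M1), GAPS G-b12-1 — the β-pert cell's output shape, here a hypothesis) and (AF-1) `|β¹_{k+1}(p)| ≤ C₁p_k` on the box,
`C₁ ≥ 0` (MISSING-B12 (M2), GAPS G-b12-2).  NO two-loop binder: the list is `T4LambdaMatching`'s with (TL), `C₃`,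
`c₁`, `θ₁`, `β¹¹_∞` removed; no new binder is introduced.  The rate theorems of §5 restrict to ultraviolet indices
`j ≥ k₀` (below `k₀` only the limits of §4 are proved).

WHAT THIS IS NOT.  Not a statement about Bałaban's actual β-functions (every analytic input is a binder); not the
estimate NE4 / the wall (M) (InjectedRate is ASSUMED for the family, and for a genuinely history-dependent β nothing
here bounds the two-history mismatch of β¹ — that is (M)); not an optimal rate; not the Λ-parameters of gen 9 (which
need (TL)); not a comparison of two regularisation SCHEMES (one flow; "continuum" = the `n → ∞` diagonal limit of the
SAME discrete recursion); not expectations, not the continuum limit of the MEASURES, not infinite volume, mass gap,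
Clay or summit progress.  HONEST FRAMING: rung (B)+1, fixed finite T⁴, COUPLING CONSTANTS only.

PRINTED ANCHORS (NEIGHBOURS for the SHAPE of the statements; used by no declaration; pages materialised with
`lit read doi:10.1007/bf01215223` and grepped this session): [Balaban1987RG1] p.256 (0.20) "the coupling constant
g_{k+1} is determined from the equation" (the recursion); p.259 Theorem 2 with (0.31) (the sequence `g_k ∈ ]0,γ]`
pinned at `g_K = g`, two-sided profile bounds) and the sentence after it: "A proof of this theorem, based on
perturbative calculations, will be given in a separate paper, where more precise asymptotic behavior will be proved."
(the deferral — the asymptotics and every rate are NOT PRINTED); p.264 after (1.22): "It is a smooth function defined on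
the interval [0, γ], (or analytic), uniformly bounded on this interval together with all derivatives. We will
investigate other properties in a separate paper." (the only printed regularity of β; (AF-0r)/(AF-1) as RATES are not
there); p.268 (2.12)–(2.14) (the split shape, `B12Beta`'s anchor).

DECLARATIONS (30 theorems + 2 `def` + 2 `example`s; no `structure`, no `sorry`, no `axiom`; v1.1 added the four
`…_unif` / `…_inv_sqrt` theorems of §5 and the second `example`).  (§1)
`abs_tsum_nat_add_le_geom`, `sum_Ico_mul_pow_le`, `injectedRate_max_zero`; (§2) `scaleDefect` (def),
`runDefect_eq_scaleDefect`, `beta_sub_bstar_eq`, `invSq_sub_astar_eq`; (§3) `abs_scaleDefect_le_geom`,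
`abs_scaleDefect_le_prof`, `abs_scaleDefect_le_two_div_sqrt`; (§4) `tendsto_bstar`, `tendsto_scaleDefect`,
`tendsto_sum_scaleDefect_zero`, `uvDefect` (def), `uvDefect_zero`, `sum_range_add_uvDefect`,
`abs_sum_range_sub_uvDefect_le`, `abs_uvDefect_le`, `tendsto_invSq_sub_astar`, `tendsto_bare_sub_astar`,
`abs_uvDefect_le_injected`, `tendsto_twoRun_step`; (§5) `abs_invSq_sub_astar_sub_uvDefect_le`,
`abs_invSq_sub_astar_sub_uvDefect_le_unif`, `abs_run_sub_astar_sub_uvDefect_le_unif`,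
`isBigO_invSq_sub_astar_sub_uvDefect`, `isBigO_bare_sub_astar_sub_oneLoopDefect`, `log_succ_div_sqrt_le`,
`abs_bstar_sub_binf_le_inv_sqrt`, `isBigO_bstar_sub`, `isBigO_twoRun_step`, `abs_twoRun_step_sub_le_unif`; (§6) the
two `example`s.  Every `def`/`theorem` is [folklore] real analysis or
bookkeeping unless its docstring carries a `[cite:]` locator, which then points at the printed SHAPE or SETTING only,
as said there.
-/

namespace Literature.MathematicalPhysics.QuantumFieldTheory.Balaban1983to89.T4ScaleMatchingRate

open Literature.MathematicalPhysics.QuantumFieldTheory.Balaban1983to89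
open Literature.MathematicalPhysics.QuantumFieldTheory.Balaban1983to89.FlowStep
open Literature.MathematicalPhysics.QuantumFieldTheory.Balaban1983to89.T4CouplingMatching
open Literature.MathematicalPhysics.QuantumFieldTheory.Balaban1983to89.T4CauchySum (InjectedRate)
open Literature.MathematicalPhysics.QuantumFieldTheory.Balaban1983to89.T4BareCouplingChart
open Literature.MathematicalPhysics.QuantumFieldTheory.Balaban1983to89.T4ContinuumCoupling
open Literature.MathematicalPhysics.QuantumFieldTheory.Balaban1983to89.T4OneLoopAsymptotics
open Literature.MathematicalPhysics.QuantumFieldTheory.Balaban1983to89.T4ContinuumTwoLoopLaw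
open Literature.MathematicalPhysics.QuantumFieldTheory.Balaban1983to89.T4LambdaMatching
open Filter Topology Finset Asymptotics

/-! ## §1 Elementary: geometric tails, and an injected rate may be taken with a nonnegative ratio -/

/-- A geometrically dominated sequence has geometrically small series tails:
`|u i| ≤ cρ^i` (`0 ≤ ρ < 1`) ⇒ `|Σ_i u (i + k)| ≤ cρ^k/(1−ρ)`. [folklore] -/
theorem abs_tsum_nat_add_le_geom {u : ℕ → ℝ} {c ρ : ℝ} (hρ0 : 0 ≤ ρ) (hρ1 : ρ < 1)
    (h : ∀ i, |u i| ≤ c * ρ ^ i) (k : ℕ) : |∑' i, u (i + k)| ≤ c * ρ ^ k / (1 - ρ) := by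
  have hg : HasSum (fun i : ℕ => c * ρ ^ k * ρ ^ i) (c * ρ ^ k * (1 - ρ)⁻¹) :=
    (hasSum_geometric_of_lt_one hρ0 hρ1).mul_left (c * ρ ^ k)
  have hb : ∀ i, ‖u (i + k)‖ ≤ c * ρ ^ k * ρ ^ i := fun i => by
    rw [Real.norm_eq_abs, mul_assoc, ← pow_add, add_comm k i]
    exact h (i + k)
  have := tsum_of_norm_bounded hg hb
  rw [Real.norm_eq_abs] at this
  simpa [div_eq_mul_inv, mul_assoc] using this

/-- `Σ_{i ∈ [J, K)} cρ^i ≤ cρ^J/(1−ρ)` for `0 ≤ ρ < 1`, `0 ≤ c`. [folklore] -/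
theorem sum_Ico_mul_pow_le {c ρ : ℝ} (hc : 0 ≤ c) (hρ0 : 0 ≤ ρ) (hρ1 : ρ < 1) (J K : ℕ) :
    ∑ i ∈ Ico J K, c * ρ ^ i ≤ c * ρ ^ J / (1 - ρ) := by
  rw [← mul_sum, mul_div_assoc]
  exact mul_le_mul_of_nonneg_left (geom_sum_Ico_le_of_lt_one hρ0 hρ1) hc

/-- AN INJECTED RATE MAY BE TAKEN WITH A NONNEGATIVE RATIO: `InjectedRate C 0 θ inj ⇒ InjectedRate C 0 (max θ 0) inj`
(if `θ < 0` the instance `K = j = 1` forces `C = 0`). [folklore] -/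
theorem injectedRate_max_zero {C θ : ℝ} {inj : ℕ → ℕ → ℝ} (h : InjectedRate C 0 θ inj) :
    InjectedRate C 0 (max θ 0) inj := by
  intro K j hj
  refine ⟨(h K j hj).1, ?_⟩
  rcases le_or_gt 0 θ with hθ | hθ
  · rw [max_eq_left hθ]; exact (h K j hj).2
  · have hC0 : 0 ≤ C := by simpa using h.const_nonneg 0
    have h11 := h 1 1 le_rfl
    have hCθ : 0 ≤ C * θ := by have := h11.1.trans h11.2; simpa using this
    have hC : C = 0 := by nlinarith
    have h2 := (h K j hj).2
    rw [hC] at h2 ⊢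
    simpa using h2

section Matching

variable {β : HBeta} {g : ℕ → ℕ → ℝ} {γ gIR C θ b C₁ binf c₀ θ₀ : ℝ} {k₀ : ℕ}

/-! ## §2 The scale defect and the bookkeeping identity at every ultraviolet index -/

/-- THE SCALE DEFECT of run `K` at index `i < K` against the continuum: `W_K(i) := β¹_i(g_K(0..i)) − (b⋆_{K−1−i} − β⁰_∞)`
— the β¹-value on the lattice trajectory minus the β¹-value of the continuum trajectory at the same distance from the
pin (`b⋆_m − β⁰_∞ = lim_n β¹_n` along the diagonal, `T4ContinuumCoupling.tendsto_beta1_diag`).  No two-loop datum enters.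
[folklore] -/
noncomputable def scaleDefect (S : B12Beta.OneLoopSplit β) (g : ℕ → ℕ → ℝ) (binf : ℝ) (K i : ℕ) : ℝ :=
  S.β1 i (prefixOf (g K) i) - (bstar g (K - 1 - i) - binf)

/-- Gen 9's two-loop-renormalised defect `T4LambdaMatching.runDefect` IS the scale defect, for EVERY value of the
two-loop coefficient (`T4LambdaMatching.runDefect_eq`). [folklore] -/
theorem runDefect_eq_scaleDefect (S : B12Beta.OneLoopSplit β) (b1inf : ℝ) {K i : ℕ} (hiK : i < K) :
    runDefect S g binf b1inf K i = scaleDefect S g binf K i :=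
  runDefect_eq S hiK

/-- The flow term splits scale by scale: `β_i(g_K(0..i)) − b⋆_{K−1−i} = (β⁰_i − β⁰_∞) + W_K(i)`. [folklore] -/
theorem beta_sub_bstar_eq (S : B12Beta.OneLoopSplit β) (binf : ℝ) (K i : ℕ) :
    β i (prefixOf (g K) i) - bstar g (K - 1 - i) = (S.β0 i - binf) + scaleDefect S g binf K i := by
  unfold scaleDefect
  rw [S.split i]
  ring

/-- THE BOOKKEEPING IDENTITY AT ULTRAVIOLET INDEX `j`: for the run with `j + m` steps,
`1/g_{j+m}(j)² − a⋆_m = Σ_{l<m} (β⁰_{j+l} − β⁰_∞) + Σ_{l<m} W_{j+m}(j+l)` — the telescoped (0.20) from index `j` to the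
pin (`T4OneLoopAsymptotics.invSq_eq_split_sum`) against the continuum one (`T4OneLoopAsymptotics.astar_eq_sum`,
`T4ContinuumCoupling.astar_zero`). [cite: Balaban1987RG1, (0.20) p.256 and (2.12)–(2.14) p.268] -/
theorem invSq_sub_astar_eq (S : B12Beta.OneLoopSplit β) (hθ1 : θ < 1)
    (hinj : InjectedRate C 0 θ (fun K j => disc (g K) (g (K + 1)) j)) (hrun : ∀ K, RGEqH K β (g K))
    (hpin : ∀ K, g K K = gIR) (m j : ℕ) :
    invSq g m j - astar g m =
      ∑ l ∈ range m, (S.β0 (j + l) - binf) + ∑ l ∈ range m, scaleDefect S g binf (j + m) (j + l) := by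
  have h1 := invSq_eq_split_sum S (hrun (j + m)) (i := j) (Nat.le_add_right j m)
  have h2 := astar_eq_sum (g := g) m
  have h0 := astar_zero hθ1 hinj hpin
  have e1 : ∑ k ∈ Ico j (j + m), S.β0 k = ∑ l ∈ range m, S.β0 (j + l) := by
    rw [sum_Ico_eq_sum_range, Nat.add_sub_cancel_left]
  have e2 : ∑ k ∈ Ico j (j + m), S.β1 k (prefixOf (g (j + m)) k) =
      ∑ l ∈ range m, S.β1 (j + l) (prefixOf (g (j + m)) (j + l)) := by
    rw [sum_Ico_eq_sum_range, Nat.add_sub_cancel_left]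
  have e3 : ∑ l ∈ range m, scaleDefect S g binf (j + m) (j + l) =
      ∑ l ∈ range m, S.β1 (j + l) (prefixOf (g (j + m)) (j + l)) - ∑ l ∈ range m, (bstar g l - binf) := by
    rw [← sum_range_reflect (fun l => bstar g l - binf) m, ← sum_sub_distrib]
    refine sum_congr rfl fun l hl => ?_
    have hl' := mem_range.1 hl
    unfold scaleDefect
    rw [show j + m - 1 - (j + l) = m - 1 - l by omega]
  rw [e3, sum_sub_distrib, sum_sub_distrib, sum_const, card_range, nsmul_eq_mul, invSq_def, h1, hpin (j + m), e1, e2,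
    h2, h0]
  ring

/-! ## §3 Two bounds on the scale defect: geometric in the ultraviolet index, profile in the distance from the pin -/

/-- THE GEOMETRIC BOUND (all indices, uniform in the run): for `i < K`,
`|W_K(i)| ≤ Cθ^i/(1−θ) + Cθ^{i+1}/(1−θ) + c₀θ₀^i` — node U2's diagonal rate
`T4ContinuumCoupling.abs_beta_diag_sub_bstar_le` and (AF-0r). [folklore] -/
theorem abs_scaleDefect_le_geom (S : B12Beta.OneLoopSplit β) (hθ1 : θ < 1)
    (hinj : InjectedRate C 0 θ (fun K j => disc (g K) (g (K + 1)) j)) (hrun : ∀ K, RGEqH K β (g K))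
    (hrate : ∀ k, |S.β0 k - binf| ≤ c₀ * θ₀ ^ k) {K i : ℕ} (hiK : i < K) :
    |scaleDefect S g binf K i| ≤ C * θ ^ i / (1 - θ) + C * θ ^ (i + 1) / (1 - θ) + c₀ * θ₀ ^ i := by
  obtain ⟨m, rfl⟩ : ∃ m, K = i + m + 1 := ⟨K - 1 - i, by omega⟩
  have e : scaleDefect S g binf (i + m + 1) i =
      (β i (prefixOf (g (i + m + 1)) i) - bstar g m) - (S.β0 i - binf) := by
    have h := beta_sub_bstar_eq (g := g) S binf (i + m + 1) i
    rw [show i + m + 1 - 1 - i = m by omega] at h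
    linarith
  rw [e]
  exact (abs_sub _ _).trans (add_le_add (abs_beta_diag_sub_bstar_le hθ1 hinj hrun m i) (hrate i))

/-- THE PROFILE BOUND (indices `k₀ ≤ i < K`): `|W_K(i)| ≤ C₁/√(b(K−i)) + C₁/(1/g_IR² + b(K−i))^{1/2}` — (AF-1) on the
lattice trajectory with the asymptotic-freedom profile `g_K(i) ≤ (b(K−i))^{−1/2}` (`T4OneLoopAsymptotics.run_le_inv_sqrt`),
and in the continuum `|b⋆_m − β⁰_∞| ≤ C₁ g⋆_{m+1} ≤ C₁ (1/g_IR² + b(m+1))^{−1/2}`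
(`T4ContinuumCoupling.abs_bstar_sub_binf_le`, `gstar_le_inv_sprof`). [cite: Balaban1987RG1, (0.31) p.259] for the
profile shape only. -/
theorem abs_scaleDefect_le_prof (S : B12Beta.OneLoopSplit β) (hθ1 : θ < 1)
    (hinj : InjectedRate C 0 θ (fun K j => disc (g K) (g (K + 1)) j)) (hrun : ∀ K, RGEqH K β (g K))
    (hbox : ∀ K i, i ≤ K → 0 < g K i ∧ g K i ≤ γ) (hpin : ∀ K, g K K = gIR)
    (hb : 0 < b) (hlo : EventualLowerH b γ k₀ β) (hC₁ : 0 ≤ C₁)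
    (hAF1 : ∀ k (p : Fin (k + 1) → ℝ), p ∈ Box γ k → |S.β1 k p| ≤ C₁ * p (Fin.last k))
    (hθ₀0 : 0 ≤ θ₀) (hθ₀1 : θ₀ < 1) (hrate : ∀ k, |S.β0 k - binf| ≤ c₀ * θ₀ ^ k) {K i : ℕ} (hk₀ : k₀ ≤ i)
    (hiK : i < K) :
    |scaleDefect S g binf K i| ≤ C₁ / Real.sqrt (b * ((K - i : ℕ) : ℝ)) + C₁ / sprof gIR b (K - i) := by
  have hconv : Tendsto S.β0 atTop (𝓝 binf) := tendsto_of_abs_sub_le_geom hθ₀0 hθ₀1 hrate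
  have h1 : |S.β1 i (prefixOf (g K) i)| ≤ C₁ / Real.sqrt (b * ((K - i : ℕ) : ℝ)) := by
    have ha : |S.β1 i (prefixOf (g K) i)| ≤ C₁ * g K i := by
      simpa using hAF1 i _ (prefixOf_mem_box hiK.le (hbox K))
    have hb' := run_le_inv_sqrt (hrun K) (hbox K) hb hlo hk₀ hiK
    calc |S.β1 i (prefixOf (g K) i)| ≤ C₁ * g K i := ha
      _ ≤ C₁ * (1 / Real.sqrt (b * ((K - i : ℕ) : ℝ))) := mul_le_mul_of_nonneg_left hb' hC₁
      _ = C₁ / Real.sqrt (b * ((K - i : ℕ) : ℝ)) := by ring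
  have h2 : |bstar g (K - 1 - i) - binf| ≤ C₁ / sprof gIR b (K - i) := by
    have ha := abs_bstar_sub_binf_le S hθ1 hinj hrun hbox hconv hAF1 (K - 1 - i)
    have hb' := gstar_le_inv_sprof hθ1 hinj hrun hbox hpin hlo hb.le (K - 1 - i + 1)
    rw [show K - 1 - i + 1 = K - i by omega] at ha hb'
    calc |bstar g (K - 1 - i) - binf| ≤ C₁ * gstar g (K - i) := ha
      _ ≤ C₁ * (1 / sprof gIR b (K - i)) := mul_le_mul_of_nonneg_left hb' hC₁
      _ = C₁ / sprof gIR b (K - i) := by ring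
  unfold scaleDefect
  exact (abs_sub _ _).trans (add_le_add h1 h2)

/-- … hence `|W_K(i)| ≤ 2C₁/√(b(K−i))` for `k₀ ≤ i < K` (`1/g_IR² + b(K−i) ≥ b(K−i)`). [folklore] -/
theorem abs_scaleDefect_le_two_div_sqrt (S : B12Beta.OneLoopSplit β) (hθ1 : θ < 1)
    (hinj : InjectedRate C 0 θ (fun K j => disc (g K) (g (K + 1)) j)) (hrun : ∀ K, RGEqH K β (g K))
    (hbox : ∀ K i, i ≤ K → 0 < g K i ∧ g K i ≤ γ) (hpin : ∀ K, g K K = gIR)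
    (hb : 0 < b) (hlo : EventualLowerH b γ k₀ β) (hC₁ : 0 ≤ C₁)
    (hAF1 : ∀ k (p : Fin (k + 1) → ℝ), p ∈ Box γ k → |S.β1 k p| ≤ C₁ * p (Fin.last k))
    (hθ₀0 : 0 ≤ θ₀) (hθ₀1 : θ₀ < 1) (hrate : ∀ k, |S.β0 k - binf| ≤ c₀ * θ₀ ^ k) {K i : ℕ} (hk₀ : k₀ ≤ i)
    (hiK : i < K) :
    |scaleDefect S g binf K i| ≤ 2 * C₁ / Real.sqrt (b * ((K - i : ℕ) : ℝ)) := by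
  have h := abs_scaleDefect_le_prof S hθ1 hinj hrun hbox hpin hb hlo hC₁ hAF1 hθ₀0 hθ₀1 hrate hk₀ hiK
  have hn : (0 : ℝ) < ((K - i : ℕ) : ℝ) := by exact_mod_cast Nat.sub_pos_of_lt hiK
  have hbn : 0 < b * ((K - i : ℕ) : ℝ) := mul_pos hb hn
  have hs : 0 < Real.sqrt (b * ((K - i : ℕ) : ℝ)) := Real.sqrt_pos.2 hbn
  have hgIR : 0 < gIR := by rw [← hpin 0]; exact (hbox 0 0 le_rfl).1
  have hle : Real.sqrt (b * ((K - i : ℕ) : ℝ)) ≤ sprof gIR b (K - i) := by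
    unfold sprof prof
    exact Real.sqrt_le_sqrt (le_add_of_nonneg_left (by positivity))
  have h3 : C₁ / sprof gIR b (K - i) ≤ C₁ / Real.sqrt (b * ((K - i : ℕ) : ℝ)) :=
    div_le_div_of_nonneg_left hC₁ hs hle
  calc |scaleDefect S g binf K i| ≤ _ := h
    _ ≤ C₁ / Real.sqrt (b * ((K - i : ℕ) : ℝ)) + C₁ / Real.sqrt (b * ((K - i : ℕ) : ℝ)) := add_le_add le_rfl h3
    _ = 2 * C₁ / Real.sqrt (b * ((K - i : ℕ) : ℝ)) := by ring

/-! ## §4 The matching at every ultraviolet index, (TL)-free: one Tannery pass on the geometric majorant -/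

/-- The continuum β-values tend to the one-loop coefficient: `b⋆_m → β⁰_∞` (`|b⋆_m − β⁰_∞| ≤ C₁ g⋆_{m+1}`,
`T4ContinuumCoupling.abs_bstar_sub_binf_le`, and `g⋆ → 0`, `T4LambdaMatching.tendsto_gstar_zero`). [folklore] -/
theorem tendsto_bstar (S : B12Beta.OneLoopSplit β) (hθ1 : θ < 1)
    (hinj : InjectedRate C 0 θ (fun K j => disc (g K) (g (K + 1)) j)) (hrun : ∀ K, RGEqH K β (g K))
    (hbox : ∀ K i, i ≤ K → 0 < g K i ∧ g K i ≤ γ) (hpin : ∀ K, g K K = gIR)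
    (hb : 0 < b) (hlo : EventualLowerH b γ k₀ β)
    (hAF1 : ∀ k (p : Fin (k + 1) → ℝ), p ∈ Box γ k → |S.β1 k p| ≤ C₁ * p (Fin.last k))
    (hθ₀0 : 0 ≤ θ₀) (hθ₀1 : θ₀ < 1) (hrate : ∀ k, |S.β0 k - binf| ≤ c₀ * θ₀ ^ k) :
    Tendsto (fun m => bstar g m) atTop (𝓝 binf) := by
  have hconv : Tendsto S.β0 atTop (𝓝 binf) := tendsto_of_abs_sub_le_geom hθ₀0 hθ₀1 hrate
  have h1 : ∀ m, |bstar g m - binf| ≤ C₁ * gstar g (m + 1) := fun m =>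
    abs_bstar_sub_binf_le S hθ1 hinj hrun hbox hconv hAF1 m
  have h2 : Tendsto (fun m => C₁ * gstar g (m + 1)) atTop (𝓝 0) := by
    have h := ((tendsto_gstar_zero hθ1 hinj hrun hbox hpin hb hlo).comp (tendsto_add_atTop_nat 1)).const_mul C₁
    simpa [Function.comp_def] using h
  have h3 : Tendsto (fun m => |bstar g m - binf|) atTop (𝓝 0) := squeeze_zero (fun m => abs_nonneg _) h1 h2
  rw [tendsto_iff_norm_sub_tendsto_zero]
  simpa [Real.norm_eq_abs] using h3

/-- TERMWISE: for every ultraviolet index `j` and offset `l`, the scale defect `W_{j+m}(j+l) → 0` as `m → ∞` — on the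
lattice side `|β¹_{j+l}(g_{j+m}(0..j+l))| ≤ C₁ g_{j+m}(j+l) → 0` (`T4LambdaMatching.tendsto_run_zero`, valid at EVERY
index, also below `k₀`), on the continuum side `b⋆_{m−1−l} → β⁰_∞` (`tendsto_bstar`). No two-loop input. [folklore] -/
theorem tendsto_scaleDefect (S : B12Beta.OneLoopSplit β) (hθ1 : θ < 1)
    (hinj : InjectedRate C 0 θ (fun K j => disc (g K) (g (K + 1)) j)) (hrun : ∀ K, RGEqH K β (g K))
    (hbox : ∀ K i, i ≤ K → 0 < g K i ∧ g K i ≤ γ) (hpin : ∀ K, g K K = gIR)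
    (hb : 0 < b) (hlo : EventualLowerH b γ k₀ β) (hC₁ : 0 ≤ C₁)
    (hAF1 : ∀ k (p : Fin (k + 1) → ℝ), p ∈ Box γ k → |S.β1 k p| ≤ C₁ * p (Fin.last k))
    (hθ₀0 : 0 ≤ θ₀) (hθ₀1 : θ₀ < 1) (hrate : ∀ k, |S.β0 k - binf| ≤ c₀ * θ₀ ^ k) (j l : ℕ) :
    Tendsto (fun m => scaleDefect S g binf (j + m) (j + l)) atTop (𝓝 0) := by
  -- lattice side
  have hg0 : Tendsto (fun m => g (j + m) (j + l)) atTop (𝓝 0) := by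
    have h := (tendsto_run_zero S hrun hbox hb hlo hC₁ hAF1 hθ₀0 hθ₀1 hrate (j + l)).comp (tendsto_add_atTop_nat j)
    refine (tendsto_congr fun m => ?_).1 h
    simp [Nat.add_comm m j]
  have ha : Tendsto (fun m => S.β1 (j + l) (prefixOf (g (j + m)) (j + l))) atTop (𝓝 0) := by
    refine squeeze_zero_norm' ?_ (by simpa using hg0.const_mul C₁)
    filter_upwards [eventually_ge_atTop l] with m hm
    rw [Real.norm_eq_abs]
    simpa using hAF1 (j + l) _ (prefixOf_mem_box (by omega : j + l ≤ j + m) (hbox (j + m)))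
  -- continuum side
  have hb' : Tendsto (fun m => bstar g (j + m - 1 - (j + l)) - binf) atTop (𝓝 0) := by
    have h := tendsto_bstar S hθ1 hinj hrun hbox hpin hb hlo hAF1 hθ₀0 hθ₀1 hrate
    have h2 : Tendsto (fun m : ℕ => j + m - 1 - (j + l)) atTop atTop :=
      tendsto_atTop_atTop.2 fun n => ⟨n + l + 1, fun m hm => by omega⟩
    have h3 := (h.comp h2).sub (tendsto_const_nhds (x := binf))
    rw [sub_self] at h3
    simpa [Function.comp_def] using h3
  have h := ha.sub hb'
  rw [sub_zero] at h
  simpa [scaleDefect] using h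

/-- **THE SCALE DEFECTS SUM TO ZERO, WITHOUT (TL)**: `Σ_{l<m} W_{j+m}(j+l) → 0` as `m → ∞`, for every `j` — ONE passage
of Tannery's theorem (`T4LambdaMatching.tendsto_sum_range_of_dominated`) on the WHOLE range: the geometric bound
`abs_scaleDefect_le_geom` is a majorant SUMMABLE IN THE ULTRAVIOLET OFFSET `l` UNIFORMLY IN THE RUN, and every term
tends to `0` (`tendsto_scaleDefect`).  (Gen 9's `T4LambdaMatching.tendsto_sum_runDefect_zero` reached the case `j = 0`
through the two-loop split (TL) and a moving split of the range; neither is needed.) [folklore] -/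
theorem tendsto_sum_scaleDefect_zero (S : B12Beta.OneLoopSplit β) (hθ1 : θ < 1)
    (hinj : InjectedRate C 0 θ (fun K j => disc (g K) (g (K + 1)) j)) (hrun : ∀ K, RGEqH K β (g K))
    (hbox : ∀ K i, i ≤ K → 0 < g K i ∧ g K i ≤ γ) (hpin : ∀ K, g K K = gIR)
    (hb : 0 < b) (hlo : EventualLowerH b γ k₀ β) (hC₁ : 0 ≤ C₁)
    (hAF1 : ∀ k (p : Fin (k + 1) → ℝ), p ∈ Box γ k → |S.β1 k p| ≤ C₁ * p (Fin.last k))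
    (hθ₀0 : 0 ≤ θ₀) (hθ₀1 : θ₀ < 1) (hrate : ∀ k, |S.β0 k - binf| ≤ c₀ * θ₀ ^ k) (j : ℕ) :
    Tendsto (fun m => ∑ l ∈ range m, scaleDefect S g binf (j + m) (j + l)) atTop (𝓝 0) := by
  -- take the injected rate with the nonnegative ratio θ' = max θ 0
  have hinj' := injectedRate_max_zero hinj
  have hθ'0 : 0 ≤ max θ 0 := le_max_right _ _
  have hθ'1 : max θ 0 < 1 := max_lt hθ1 one_pos
  have hC0 : 0 ≤ C := by simpa using hinj.const_nonneg 0
  have hc₀ : 0 ≤ c₀ := by have := (abs_nonneg _).trans (hrate 0); simpa using this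
  set θ' : ℝ := max θ 0 with hθ'
  -- the majorant, summable in the offset l uniformly in m
  set μ : ℕ → ℝ := fun l => C * θ' ^ (j + l) / (1 - θ') + C * θ' ^ (j + l + 1) / (1 - θ') + c₀ * θ₀ ^ (j + l)
    with hμ
  have hμs : Summable μ := by
    have g1 : Summable (fun l : ℕ => C * θ' ^ (j + l) / (1 - θ')) := by
      have := ((summable_geometric_of_lt_one hθ'0 hθ'1).mul_left (C * θ' ^ j / (1 - θ')))
      refine this.congr fun l => ?_
      rw [pow_add]; ring
    have g2 : Summable (fun l : ℕ => C * θ' ^ (j + l + 1) / (1 - θ')) := by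
      have := ((summable_geometric_of_lt_one hθ'0 hθ'1).mul_left (C * θ' ^ (j + 1) / (1 - θ')))
      refine this.congr fun l => ?_
      rw [show j + l + 1 = (j + 1) + l by omega, pow_add]; ring
    have g3 : Summable (fun l : ℕ => c₀ * θ₀ ^ (j + l)) := by
      have := ((summable_geometric_of_lt_one hθ₀0 hθ₀1).mul_left (c₀ * θ₀ ^ j))
      refine this.congr fun l => ?_
      rw [pow_add]; ring
    exact (g1.add g2).add g3
  have h := tendsto_sum_range_of_dominated (F := fun m l => scaleDefect S g binf (j + m) (j + l)) (N := fun m => m)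
    (φ := fun _ => 0) hμs tendsto_id
    (fun l => tendsto_scaleDefect S hθ1 hinj hrun hbox hpin hb hlo hC₁ hAF1 hθ₀0 hθ₀1 hrate j l)
    (Eventually.of_forall fun m l hl =>
      abs_scaleDefect_le_geom S hθ'1 hinj' hrun hrate (by omega : j + l < j + m))
  rwa [tsum_zero] at h

/-- THE ONE-LOOP ULTRAVIOLET DEFECT FROM INDEX `j` ON: `δ_j := Σ_i (β⁰_{j+i} − β⁰_∞)` (absolutely convergent under
(AF-0r); `δ_0 = T4LambdaMatching.oneLoopDefect`, `uvDefect_zero`). [folklore] -/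
noncomputable def uvDefect (S : B12Beta.OneLoopSplit β) (binf : ℝ) (j : ℕ) : ℝ :=
  ∑' i, (S.β0 (j + i) - binf)

/-- `δ_0 = δ₀` (`T4LambdaMatching.oneLoopDefect`). [folklore] -/
theorem uvDefect_zero (S : B12Beta.OneLoopSplit β) (binf : ℝ) : uvDefect S binf 0 = oneLoopDefect S binf := by
  simp [uvDefect, oneLoopDefect]

/-- `δ₀ = Σ_{i<j} (β⁰_i − β⁰_∞) + δ_j`. [folklore] -/
theorem sum_range_add_uvDefect (S : B12Beta.OneLoopSplit β) (hθ₀0 : 0 ≤ θ₀) (hθ₀1 : θ₀ < 1)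
    (hrate : ∀ k, |S.β0 k - binf| ≤ c₀ * θ₀ ^ k) (j : ℕ) :
    ∑ i ∈ range j, (S.β0 i - binf) + uvDefect S binf j = oneLoopDefect S binf := by
  have h := (summable_beta0_sub S hθ₀0 hθ₀1 hrate).sum_add_tsum_nat_add j
  unfold uvDefect oneLoopDefect
  rw [← h]
  congr 1
  exact tsum_congr fun i => by rw [Nat.add_comm j i]

/-- The partial sums converge to `δ_j` with the geometric tail of (AF-0r):
`|Σ_{l<m} (β⁰_{j+l} − β⁰_∞) − δ_j| ≤ c₀θ₀^{j+m}/(1−θ₀)`. [folklore] -/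
theorem abs_sum_range_sub_uvDefect_le (S : B12Beta.OneLoopSplit β) (hθ₀0 : 0 ≤ θ₀) (hθ₀1 : θ₀ < 1)
    (hrate : ∀ k, |S.β0 k - binf| ≤ c₀ * θ₀ ^ k) (j m : ℕ) :
    |∑ l ∈ range m, (S.β0 (j + l) - binf) - uvDefect S binf j| ≤ c₀ * θ₀ ^ (j + m) / (1 - θ₀) := by
  have hs : Summable (fun l => S.β0 (j + l) - binf) := by
    have h := (summable_nat_add_iff j).2 (summable_beta0_sub S hθ₀0 hθ₀1 hrate)
    exact h.congr fun l => by rw [Nat.add_comm l j]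
  have h := hs.sum_add_tsum_nat_add m
  have hrate' : ∀ i, |S.β0 (j + i) - binf| ≤ c₀ * θ₀ ^ j * θ₀ ^ i := fun i => by
    rw [mul_assoc, ← pow_add]; exact hrate (j + i)
  have ht := abs_tsum_nat_add_le_geom (u := fun i => S.β0 (j + i) - binf) hθ₀0 hθ₀1 hrate' m
  unfold uvDefect
  rw [← h, show ∑ l ∈ range m, (S.β0 (j + l) - binf) -
      (∑ l ∈ range m, (S.β0 (j + l) - binf) + ∑' i, (S.β0 (j + (i + m)) - binf)) =
      -∑' i, (S.β0 (j + (i + m)) - binf) by ring, abs_neg]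
  calc |∑' i, (S.β0 (j + (i + m)) - binf)| ≤ c₀ * θ₀ ^ j * θ₀ ^ m / (1 - θ₀) := ht
    _ = c₀ * θ₀ ^ (j + m) / (1 - θ₀) := by rw [pow_add, mul_assoc]

/-- `|δ_j| ≤ c₀θ₀^j/(1−θ₀)`: the one-loop defect from index `j` on is geometrically small. [folklore] -/
theorem abs_uvDefect_le (S : B12Beta.OneLoopSplit β) (hθ₀0 : 0 ≤ θ₀) (hθ₀1 : θ₀ < 1)
    (hrate : ∀ k, |S.β0 k - binf| ≤ c₀ * θ₀ ^ k) (j : ℕ) : |uvDefect S binf j| ≤ c₀ * θ₀ ^ j / (1 - θ₀) := by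
  have h := abs_sum_range_sub_uvDefect_le S hθ₀0 hθ₀1 hrate j 0
  simpa [abs_neg] using h

/-- **THE MATCHING AT EVERY ULTRAVIOLET INDEX, (TL)-FREE.**  For a family of box runs of (0.20) pinned at
`g_K(K) = g_IR`, under node U2's OUTPUT SHAPE `InjectedRate C 0 θ (disc …)` (`θ < 1`), `EventualLowerH b γ k₀ β`
(`b > 0`), the printed split shape `B12Beta.OneLoopSplit` with (AF-0r) IN RATE FORM `|β⁰_k − β⁰_∞| ≤ c₀θ₀^k` and
(AF-1) `|β¹_{k+1}(p)| ≤ C₁p_k` — ALL NAMED BINDERS, NOT PRINTED for Bałaban's β; NO two-loop input — for EVERY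
ultraviolet index `j`: **`1/g_{j+m}(j)² − a⋆_m → δ_j = Σ_i (β⁰_{j+i} − β⁰_∞)`** as `m → ∞`.  The lattice recursion
variable `j` steps below the bare end and the continuum one at the same distance `m` from the pin differ, in the
limit, by the one-loop ultraviolet defect from index `j` on and by nothing else. [cite: Balaban1987RG1, Theorem 2 p.259]
for the SETTING only (the sequence pinned at g_K = g; "more precise asymptotic behavior will be proved" — deferred
there and NOT PRINTED); the statement is this file's, over the binders. -/
theorem tendsto_invSq_sub_astar (S : B12Beta.OneLoopSplit β) (hθ1 : θ < 1)
    (hinj : InjectedRate C 0 θ (fun K j => disc (g K) (g (K + 1)) j)) (hrun : ∀ K, RGEqH K β (g K))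
    (hbox : ∀ K i, i ≤ K → 0 < g K i ∧ g K i ≤ γ) (hpin : ∀ K, g K K = gIR)
    (hb : 0 < b) (hlo : EventualLowerH b γ k₀ β) (hC₁ : 0 ≤ C₁)
    (hAF1 : ∀ k (p : Fin (k + 1) → ℝ), p ∈ Box γ k → |S.β1 k p| ≤ C₁ * p (Fin.last k))
    (hθ₀0 : 0 ≤ θ₀) (hθ₀1 : θ₀ < 1) (hrate : ∀ k, |S.β0 k - binf| ≤ c₀ * θ₀ ^ k) (j : ℕ) :
    Tendsto (fun m => invSq g m j - astar g m) atTop (𝓝 (uvDefect S binf j)) := by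
  have hs : Summable (fun l => S.β0 (j + l) - binf) := by
    have h := (summable_nat_add_iff j).2 (summable_beta0_sub S hθ₀0 hθ₀1 hrate)
    exact h.congr fun l => by rw [Nat.add_comm l j]
  have h0 := hs.tendsto_sum_tsum_nat
  have hW := tendsto_sum_scaleDefect_zero S hθ1 hinj hrun hbox hpin hb hlo hC₁ hAF1 hθ₀0 hθ₀1 hrate j
  have h := h0.add hW
  rw [add_zero] at h
  unfold uvDefect
  exact (tendsto_congr fun m => invSq_sub_astar_eq S hθ1 hinj hrun hpin (binf := binf) m j).2 h

/-- THE BARE END (`j = 0`), (TL)-FREE: `1/g_K(0)² − a⋆_K → δ₀ = Σ_j (β⁰_j − β⁰_∞)` — gen 9's matching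
`T4LambdaMatching.tendsto_invSq_bare_sub_astar` WITHOUT its two-loop binders (TL), `C₃`, `c₁`, `θ₁`, `β¹¹_∞`. [folklore] -/
theorem tendsto_bare_sub_astar (S : B12Beta.OneLoopSplit β) (hθ1 : θ < 1)
    (hinj : InjectedRate C 0 θ (fun K j => disc (g K) (g (K + 1)) j)) (hrun : ∀ K, RGEqH K β (g K))
    (hbox : ∀ K i, i ≤ K → 0 < g K i ∧ g K i ≤ γ) (hpin : ∀ K, g K K = gIR)
    (hb : 0 < b) (hlo : EventualLowerH b γ k₀ β) (hC₁ : 0 ≤ C₁)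
    (hAF1 : ∀ k (p : Fin (k + 1) → ℝ), p ∈ Box γ k → |S.β1 k p| ≤ C₁ * p (Fin.last k))
    (hθ₀0 : 0 ≤ θ₀) (hθ₀1 : θ₀ < 1) (hrate : ∀ k, |S.β0 k - binf| ≤ c₀ * θ₀ ^ k) :
    Tendsto (fun K => 1 / (g K 0) ^ 2 - astar g K) atTop (𝓝 (oneLoopDefect S binf)) := by
  have h := tendsto_invSq_sub_astar S hθ1 hinj hrun hbox hpin hb hlo hC₁ hAF1 hθ₀0 hθ₀1 hrate 0
  rw [uvDefect_zero] at h
  refine (tendsto_congr fun K => ?_).1 h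
  simp [invSq]

/-- THE INJECTED RATE DOMINATES THE ONE-LOOP DEFECTS: `|δ_j| ≤ Cθ^j/(1−θ)` for every `j` — the `K`-uniform tail
`|1/g_{j+m}(j)² − a⋆_m| ≤ Cθ^j/(1−θ)` of node U2 (`T4ContinuumCoupling.abs_invSq_sub_astar_le`) passes to the limit
`m → ∞`.  A necessary condition tying the (AF-0r) data to node U2's output shape. [folklore] -/
theorem abs_uvDefect_le_injected (S : B12Beta.OneLoopSplit β) (hθ1 : θ < 1)
    (hinj : InjectedRate C 0 θ (fun K j => disc (g K) (g (K + 1)) j)) (hrun : ∀ K, RGEqH K β (g K))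
    (hbox : ∀ K i, i ≤ K → 0 < g K i ∧ g K i ≤ γ) (hpin : ∀ K, g K K = gIR)
    (hb : 0 < b) (hlo : EventualLowerH b γ k₀ β) (hC₁ : 0 ≤ C₁)
    (hAF1 : ∀ k (p : Fin (k + 1) → ℝ), p ∈ Box γ k → |S.β1 k p| ≤ C₁ * p (Fin.last k))
    (hθ₀0 : 0 ≤ θ₀) (hθ₀1 : θ₀ < 1) (hrate : ∀ k, |S.β0 k - binf| ≤ c₀ * θ₀ ^ k) (j : ℕ) :
    |uvDefect S binf j| ≤ C * θ ^ j / (1 - θ) :=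
  le_of_tendsto' (tendsto_invSq_sub_astar S hθ1 hinj hrun hbox hpin hb hlo hC₁ hAF1 hθ₀0 hθ₀1 hrate j).abs
    fun m => abs_invSq_sub_astar_le hθ1 hinj m j

/-- **THE TWO-TRAJECTORY SCALE STEP AT A FIXED ULTRAVIOLET INDEX, (TL)-FREE** — the matching of the two pinned
lattice trajectories with `K+1` and `K` renormalisation steps (lattice spacings `ε/L` and `ε` below the same unit
scale) AT THE SAME SCALE `j`: `1/g_{j+m+1}(j)² − 1/g_{j+m}(j)² → β⁰_∞` as `m → ∞`, for EVERY `j` —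
`tendsto_invSq_sub_astar` at `m+1` and at `m` have the SAME limit `δ_j`, and `b⋆_m = a⋆_{m+1} − a⋆_m → β⁰_∞`
(`tendsto_bstar`). [folklore] -/
theorem tendsto_twoRun_step (S : B12Beta.OneLoopSplit β) (hθ1 : θ < 1)
    (hinj : InjectedRate C 0 θ (fun K j => disc (g K) (g (K + 1)) j)) (hrun : ∀ K, RGEqH K β (g K))
    (hbox : ∀ K i, i ≤ K → 0 < g K i ∧ g K i ≤ γ) (hpin : ∀ K, g K K = gIR)
    (hb : 0 < b) (hlo : EventualLowerH b γ k₀ β) (hC₁ : 0 ≤ C₁)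
    (hAF1 : ∀ k (p : Fin (k + 1) → ℝ), p ∈ Box γ k → |S.β1 k p| ≤ C₁ * p (Fin.last k))
    (hθ₀0 : 0 ≤ θ₀) (hθ₀1 : θ₀ < 1) (hrate : ∀ k, |S.β0 k - binf| ≤ c₀ * θ₀ ^ k) (j : ℕ) :
    Tendsto (fun m => invSq g (m + 1) j - invSq g m j) atTop (𝓝 binf) := by
  have hD := tendsto_invSq_sub_astar S hθ1 hinj hrun hbox hpin hb hlo hC₁ hAF1 hθ₀0 hθ₀1 hrate j
  have hD1 := hD.comp (tendsto_add_atTop_nat 1)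
  have hb' := tendsto_bstar S hθ1 hinj hrun hbox hpin hb hlo hAF1 hθ₀0 hθ₀1 hrate
  have h := (hD1.sub hD).add hb'
  rw [sub_self, zero_add] at h
  refine (tendsto_congr fun m => ?_).1 h
  simp only [Function.comp_def, bstar]
  ring

/-! ## §5 The rate: a two-piece bound with a free cut, the `O(log m/√m)` law, and its uniformity (v1.1) -/

/-- **THE TWO-PIECE RATE** (explicit constants; `0 ≤ θ`, `k₀ ≤ j`).  For every cut `J ≤ m`:
`|1/g_{j+m}(j)² − a⋆_m − δ_j| ≤ 2C₁·J/√(b(m+1−J)) + C(1+θ)θ^{j+J}/(1−θ)² + c₀(θ₀^{j+J} + θ₀^{j+m})/(1−θ₀)` — the first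
`J` offsets below index `j` (far from the pin) are paid with the PROFILE bound `2C₁/√(b·distance)`
(`abs_scaleDefect_le_two_div_sqrt`), the remaining ones with the GEOMETRIC bound (`abs_scaleDefect_le_geom`), and the
one-loop partial sum with the (AF-0r) tail (`abs_sum_range_sub_uvDefect_le`).  Neither piece alone is small uniformly:
the trade-off in `J` is the rate (`isBigO_invSq_sub_astar_sub_uvDefect`). [folklore] -/
theorem abs_invSq_sub_astar_sub_uvDefect_le (S : B12Beta.OneLoopSplit β) (hθ0 : 0 ≤ θ) (hθ1 : θ < 1)
    (hinj : InjectedRate C 0 θ (fun K j => disc (g K) (g (K + 1)) j)) (hrun : ∀ K, RGEqH K β (g K))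
    (hbox : ∀ K i, i ≤ K → 0 < g K i ∧ g K i ≤ γ) (hpin : ∀ K, g K K = gIR)
    (hb : 0 < b) (hlo : EventualLowerH b γ k₀ β) (hC₁ : 0 ≤ C₁)
    (hAF1 : ∀ k (p : Fin (k + 1) → ℝ), p ∈ Box γ k → |S.β1 k p| ≤ C₁ * p (Fin.last k))
    (hθ₀0 : 0 ≤ θ₀) (hθ₀1 : θ₀ < 1) (hrate : ∀ k, |S.β0 k - binf| ≤ c₀ * θ₀ ^ k) {j J m : ℕ} (hk₀ : k₀ ≤ j)
    (hJm : J ≤ m) :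
    |invSq g m j - astar g m - uvDefect S binf j| ≤
      2 * C₁ * J / Real.sqrt (b * ((m + 1 - J : ℕ) : ℝ)) + C * (1 + θ) * θ ^ (j + J) / (1 - θ) ^ 2 +
        c₀ * (θ₀ ^ (j + J) + θ₀ ^ (j + m)) / (1 - θ₀) := by
  have hC0 : 0 ≤ C := by simpa using hinj.const_nonneg 0
  have hc₀ : 0 ≤ c₀ := by have := (abs_nonneg _).trans (hrate 0); simpa using this
  have h1θ : 0 < 1 - θ := by linarith
  have h1θ₀ : 0 < 1 - θ₀ := by linarith
  set W : ℕ → ℝ := fun l => scaleDefect S g binf (j + m) (j + l) with hW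
  -- the identity and the three pieces
  have hid := invSq_sub_astar_eq S hθ1 hinj hrun hpin (binf := binf) m j
  have hsplit : ∑ l ∈ range m, W l = ∑ l ∈ range J, W l + ∑ l ∈ Ico J m, W l :=
    (sum_range_add_sum_Ico W hJm).symm
  -- piece 1: the one-loop tail
  have T1 := abs_sum_range_sub_uvDefect_le S hθ₀0 hθ₀1 hrate j m
  -- piece 2: the profile bound on the first J offsets
  have hX : (0 : ℝ) < ((m + 1 - J : ℕ) : ℝ) := by exact_mod_cast (by omega : 0 < m + 1 - J)
  have hsX : 0 < Real.sqrt (b * ((m + 1 - J : ℕ) : ℝ)) := Real.sqrt_pos.2 (mul_pos hb hX)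
  have T2 : |∑ l ∈ range J, W l| ≤ 2 * C₁ * J / Real.sqrt (b * ((m + 1 - J : ℕ) : ℝ)) := by
    have hterm : ∀ l ∈ range J, |W l| ≤ 2 * C₁ / Real.sqrt (b * ((m + 1 - J : ℕ) : ℝ)) := by
      intro l hl
      have hl' := mem_range.1 hl
      have h := abs_scaleDefect_le_two_div_sqrt S hθ1 hinj hrun hbox hpin hb hlo hC₁ hAF1 hθ₀0 hθ₀1 hrate
        (K := j + m) (i := j + l) (by omega) (by omega)
      have e : j + m - (j + l) = m - l := by omega
      rw [e] at h
      have hle : ((m + 1 - J : ℕ) : ℝ) ≤ ((m - l : ℕ) : ℝ) := by exact_mod_cast (by omega : m + 1 - J ≤ m - l)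
      have hs : Real.sqrt (b * ((m + 1 - J : ℕ) : ℝ)) ≤ Real.sqrt (b * ((m - l : ℕ) : ℝ)) :=
        Real.sqrt_le_sqrt (mul_le_mul_of_nonneg_left hle hb.le)
      exact h.trans (div_le_div_of_nonneg_left (by positivity) hsX hs)
    calc |∑ l ∈ range J, W l| ≤ ∑ l ∈ range J, |W l| := abs_sum_le_sum_abs _ _
      _ ≤ ∑ l ∈ range J, 2 * C₁ / Real.sqrt (b * ((m + 1 - J : ℕ) : ℝ)) := sum_le_sum hterm
      _ = 2 * C₁ * J / Real.sqrt (b * ((m + 1 - J : ℕ) : ℝ)) := by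
        rw [sum_const, card_range, nsmul_eq_mul]; ring
  -- piece 3: the geometric bound on the remaining offsets
  have T3 : |∑ l ∈ Ico J m, W l| ≤
      C * (1 + θ) * θ ^ j / (1 - θ) * θ ^ J / (1 - θ) + c₀ * θ₀ ^ j * θ₀ ^ J / (1 - θ₀) := by
    have hterm : ∀ l ∈ Ico J m, |W l| ≤ C * (1 + θ) * θ ^ j / (1 - θ) * θ ^ l + c₀ * θ₀ ^ j * θ₀ ^ l := by
      intro l hl
      have hl' := (mem_Ico.1 hl).2
      have h := abs_scaleDefect_le_geom S hθ1 hinj hrun hrate (binf := binf) (K := j + m) (i := j + l) (by omega)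
      have e : C * θ ^ (j + l) / (1 - θ) + C * θ ^ (j + l + 1) / (1 - θ) + c₀ * θ₀ ^ (j + l) =
          C * (1 + θ) * θ ^ j / (1 - θ) * θ ^ l + c₀ * θ₀ ^ j * θ₀ ^ l := by
        rw [pow_succ, pow_add, pow_add]
        ring
      rw [e] at h
      exact h
    have hs1 := sum_Ico_mul_pow_le (c := C * (1 + θ) * θ ^ j / (1 - θ)) (by positivity) hθ0 hθ1 J m
    have hs2 := sum_Ico_mul_pow_le (c := c₀ * θ₀ ^ j) (by positivity) hθ₀0 hθ₀1 J m
    calc |∑ l ∈ Ico J m, W l| ≤ ∑ l ∈ Ico J m, |W l| := abs_sum_le_sum_abs _ _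
      _ ≤ ∑ l ∈ Ico J m, (C * (1 + θ) * θ ^ j / (1 - θ) * θ ^ l + c₀ * θ₀ ^ j * θ₀ ^ l) := sum_le_sum hterm
      _ = ∑ l ∈ Ico J m, C * (1 + θ) * θ ^ j / (1 - θ) * θ ^ l + ∑ l ∈ Ico J m, c₀ * θ₀ ^ j * θ₀ ^ l :=
        sum_add_distrib
      _ ≤ _ := add_le_add hs1 hs2
  -- assemble
  have e : invSq g m j - astar g m - uvDefect S binf j =
      (∑ l ∈ range m, (S.β0 (j + l) - binf) - uvDefect S binf j) + ∑ l ∈ range J, W l + ∑ l ∈ Ico J m, W l := by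
    rw [hid, hsplit]; ring
  have efin : C * (1 + θ) * θ ^ j / (1 - θ) * θ ^ J / (1 - θ) + c₀ * θ₀ ^ j * θ₀ ^ J / (1 - θ₀) +
      c₀ * θ₀ ^ (j + m) / (1 - θ₀) =
      C * (1 + θ) * θ ^ (j + J) / (1 - θ) ^ 2 + c₀ * (θ₀ ^ (j + J) + θ₀ ^ (j + m)) / (1 - θ₀) := by
    rw [pow_add, pow_add]
    field_simp
    ring
  rw [e]
  calc |∑ l ∈ range m, (S.β0 (j + l) - binf) - uvDefect S binf j + ∑ l ∈ range J, W l + ∑ l ∈ Ico J m, W l|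
      ≤ |∑ l ∈ range m, (S.β0 (j + l) - binf) - uvDefect S binf j| + |∑ l ∈ range J, W l| +
          |∑ l ∈ Ico J m, W l| := abs_add_three _ _ _
    _ ≤ c₀ * θ₀ ^ (j + m) / (1 - θ₀) + 2 * C₁ * J / Real.sqrt (b * ((m + 1 - J : ℕ) : ℝ)) +
          (C * (1 + θ) * θ ^ j / (1 - θ) * θ ^ J / (1 - θ) + c₀ * θ₀ ^ j * θ₀ ^ J / (1 - θ₀)) :=
        add_le_add (add_le_add T1 T2) T3
    _ ≤ _ := by linarith [efin]

/-- **UNIFORMITY OF THE RATE** (v1.1).  ONE constant serves EVERY pinned family of box runs of (0.20) with the given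
injected-rate data `(C, θ)`, lower envelope `(b, k₀)`, (AF-1) constant `C₁` and (AF-0r) data `(c₀, θ₀)` — every pin
`g_IR`, every ultraviolet index `j ≥ k₀` and every distance `m ≥ 2` from the pin:
`∃ A ≥ 0, ∀ (family, pin, binders), ∀ j ≥ k₀, ∀ m ≥ 2, |1/g_{j+m}(j)² − a⋆_m − δ_j| ≤ A·log m/√m`.
The ORDER OF THE QUANTIFIERS is the content: `A` is chosen before the family (it depends on `C, θ, c₀, θ₀, C₁, b` only;
explicitly `A = 2C₁/√(b/2)·(1/λ + 1/log 2) + A₀/log 2 + (2C₁M₀/√b + A₀)·√M₀/log 2` with `λ = log(1/ρ)`,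
`ρ = max(θ⁺, θ₀, 1/2)`, `A₀ = C⁺(1+θ⁺)/(1−θ⁺)² + 2c₀/(1−θ₀)`, `M₀ = max(2, ⌈(4/λ+1)²⌉)`: the two-piece bound with the cut
`J = ⌈log m/λ⌉` for `m ≥ M₀` and with the cut `J = m` below `M₀`).  [folklore] -/
theorem abs_invSq_sub_astar_sub_uvDefect_le_unif (S : B12Beta.OneLoopSplit β) (hθ1 : θ < 1) (hb : 0 < b)
    (hlo : EventualLowerH b γ k₀ β) (hC₁ : 0 ≤ C₁)
    (hAF1 : ∀ k (p : Fin (k + 1) → ℝ), p ∈ Box γ k → |S.β1 k p| ≤ C₁ * p (Fin.last k))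
    (hθ₀0 : 0 ≤ θ₀) (hθ₀1 : θ₀ < 1) (hrate : ∀ k, |S.β0 k - binf| ≤ c₀ * θ₀ ^ k) :
    ∃ A : ℝ, 0 ≤ A ∧ ∀ (G : ℕ → ℕ → ℝ) (gir : ℝ), InjectedRate C 0 θ (fun K j => disc (G K) (G (K + 1)) j) →
      (∀ K, RGEqH K β (G K)) → (∀ K i, i ≤ K → 0 < G K i ∧ G K i ≤ γ) → (∀ K, G K K = gir) →
      ∀ ⦃j : ℕ⦄, k₀ ≤ j → ∀ ⦃m : ℕ⦄, 2 ≤ m →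
        |invSq G m j - astar G m - uvDefect S binf j| ≤ A * (Real.log m / Real.sqrt m) := by
  -- data chosen BEFORE the family: θ⁺, ρ, λ, A₀, M₀, A
  set θ' : ℝ := max θ 0 with hθ'
  have hθ'0 : 0 ≤ θ' := le_max_right _ _
  have hθ'1 : θ' < 1 := max_lt hθ1 one_pos
  have hc₀ : 0 ≤ c₀ := by have := (abs_nonneg _).trans (hrate 0); simpa using this
  have h1θ' : 0 < 1 - θ' := by linarith
  have h1θ₀ : 0 < 1 - θ₀ := by linarith
  set ρ : ℝ := max (max θ' θ₀) (1 / 2) with hρ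
  have hρhalf : 1 / 2 ≤ ρ := le_max_right _ _
  have hρ0 : 0 < ρ := by linarith
  have hρ1 : ρ < 1 := max_lt (max_lt hθ'1 hθ₀1) (by norm_num)
  have hθ'ρ : θ' ≤ ρ := (le_max_left _ _).trans (le_max_left _ _)
  have hθ₀ρ : θ₀ ≤ ρ := (le_max_right _ _).trans (le_max_left _ _)
  set Cp : ℝ := max C 0 with hCp
  have hCp0 : 0 ≤ Cp := le_max_right _ _
  set A₀ : ℝ := Cp * (1 + θ') / (1 - θ') ^ 2 + 2 * (c₀ / (1 - θ₀)) with hA₀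
  have hA1 : 0 ≤ Cp * (1 + θ') / (1 - θ') ^ 2 := by positivity
  have hA2 : 0 ≤ c₀ / (1 - θ₀) := div_nonneg hc₀ h1θ₀.le
  have hA₀0 : 0 ≤ A₀ := by rw [hA₀]; positivity
  set lam : ℝ := -Real.log ρ with hlam
  have hlam0 : 0 < lam := by rw [hlam, neg_pos]; exact Real.log_neg hρ0 hρ1
  have hlog2 : 0 < Real.log 2 := Real.log_pos one_lt_two
  set M₀ : ℕ := max 2 ⌈(4 / lam + 1) ^ 2⌉₊ with hM₀
  have hM₀2 : 2 ≤ M₀ := le_max_left _ _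
  have hM₀r : (2 : ℝ) ≤ M₀ := by exact_mod_cast hM₀2
  have hsM₀ : 0 < Real.sqrt (M₀ : ℝ) := Real.sqrt_pos.2 (by linarith)
  have hsb : 0 < Real.sqrt b := Real.sqrt_pos.2 hb
  have hsb2 : 0 < Real.sqrt (b / 2) := Real.sqrt_pos.2 (by positivity)
  set Abig : ℝ := 2 * C₁ / Real.sqrt (b / 2) * (1 / lam + 1 / Real.log 2) + A₀ / Real.log 2 with hAbig
  have hAbig0 : 0 ≤ Abig := by rw [hAbig]; positivity
  set Asmall : ℝ := (2 * C₁ * M₀ / Real.sqrt b + A₀) * (Real.sqrt M₀ / Real.log 2) with hAsmall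
  have hB0 : 0 ≤ 2 * C₁ * M₀ / Real.sqrt b + A₀ := by positivity
  have hAsmall0 : 0 ≤ Asmall := by rw [hAsmall]; positivity
  refine ⟨Abig + Asmall, add_nonneg hAbig0 hAsmall0, ?_⟩
  -- now the family
  intro G gir hinj hrun hbox hpin j hk₀ m hm2
  have hinj' := injectedRate_max_zero hinj
  have hC0 : 0 ≤ C := by simpa using hinj.const_nonneg 0
  have hCpC : Cp = C := by rw [hCp]; exact max_eq_left hC0
  have hmr : (2 : ℝ) ≤ m := by exact_mod_cast hm2
  have hm0 : (0 : ℝ) < m := by linarith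
  have hlogm : Real.log 2 ≤ Real.log m := Real.log_le_log two_pos hmr
  have hlogm0 : 0 ≤ Real.log m := hlog2.le.trans hlogm
  have hs0 : 0 < Real.sqrt (m : ℝ) := Real.sqrt_pos.2 hm0
  have hsq : Real.sqrt (m : ℝ) * Real.sqrt (m : ℝ) = m := Real.mul_self_sqrt hm0.le
  have hu0 : 0 ≤ Real.log m / Real.sqrt m := div_nonneg hlogm0 hs0.le
  -- the two-piece rate with every geometric term bounded by A₀·ρ^J
  have key : ∀ J, J ≤ m → |invSq G m j - astar G m - uvDefect S binf j| ≤
      2 * C₁ * J / Real.sqrt (b * ((m + 1 - J : ℕ) : ℝ)) + A₀ * ρ ^ J := by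
    intro J hJm
    have h := abs_invSq_sub_astar_sub_uvDefect_le S hθ'0 hθ'1 hinj' hrun hbox hpin hb hlo hC₁ hAF1 hθ₀0 hθ₀1
      hrate hk₀ hJm
    have p1 : θ' ^ (j + J) ≤ ρ ^ J :=
      (pow_le_pow_left₀ hθ'0 hθ'ρ _).trans (pow_le_pow_of_le_one hρ0.le hρ1.le (by omega))
    have p2 : θ₀ ^ (j + J) ≤ ρ ^ J :=
      (pow_le_pow_left₀ hθ₀0 hθ₀ρ _).trans (pow_le_pow_of_le_one hρ0.le hρ1.le (by omega))
    have p3 : θ₀ ^ (j + m) ≤ ρ ^ J :=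
      (pow_le_pow_left₀ hθ₀0 hθ₀ρ _).trans (pow_le_pow_of_le_one hρ0.le hρ1.le (by omega))
    have hA1' : 0 ≤ C * (1 + θ') / (1 - θ') ^ 2 := by positivity
    have q1 := mul_le_mul_of_nonneg_left p1 hA1'
    have q2 := mul_le_mul_of_nonneg_left (add_le_add p2 p3) hA2
    have e1 : C * (1 + θ') * θ' ^ (j + J) / (1 - θ') ^ 2 = C * (1 + θ') / (1 - θ') ^ 2 * θ' ^ (j + J) := by ring
    have e2 : c₀ * (θ₀ ^ (j + J) + θ₀ ^ (j + m)) / (1 - θ₀) = c₀ / (1 - θ₀) * (θ₀ ^ (j + J) + θ₀ ^ (j + m)) := by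
      ring
    rw [e1, e2] at h
    have e3 : A₀ * ρ ^ J = C * (1 + θ') / (1 - θ') ^ 2 * ρ ^ J + c₀ / (1 - θ₀) * (ρ ^ J + ρ ^ J) := by
      rw [hA₀, hCpC]; ring
    rw [e3]
    linarith
  have hsmall_nn : 0 ≤ Asmall * (Real.log m / Real.sqrt m) := mul_nonneg hAsmall0 hu0
  have hbig_nn : 0 ≤ Abig * (Real.log m / Real.sqrt m) := mul_nonneg hAbig0 hu0
  rcases le_or_gt M₀ m with hMm | hmM
  · -- LARGE m: the cut J = ⌈log m / λ⌉ (the v1 computation)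
    have hmM : ⌈(4 / lam + 1) ^ 2⌉₊ ≤ m := (le_max_right _ _).trans hMm
    have hlog2le : Real.log 2 ≤ 1 := by
      have := Real.log_le_sub_one_of_pos (two_pos : (0 : ℝ) < 2); linarith
    have hlamle : lam ≤ Real.log 2 := by
      have h := Real.log_le_log (by norm_num : (0 : ℝ) < 1 / 2) hρhalf
      rw [one_div, Real.log_inv] at h
      rw [hlam]; linarith
    have h4lam : 4 ≤ 4 / lam := by
      rw [le_div_iff₀ hlam0]; linarith
    set J : ℕ := ⌈Real.log m / lam⌉₊ with hJ
    have hJlo : Real.log m / lam ≤ J := Nat.le_ceil _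
    have hJhi : (J : ℝ) < Real.log m / lam + 1 := Nat.ceil_lt_add_one (div_nonneg hlogm0 hlam0.le)
    have hsm : 4 / lam + 1 ≤ Real.sqrt m := by
      have h1 : (4 / lam + 1) ^ 2 ≤ (m : ℝ) := (Nat.le_ceil _).trans (by exact_mod_cast hmM)
      calc 4 / lam + 1 = Real.sqrt ((4 / lam + 1) ^ 2) := (Real.sqrt_sq (by positivity)).symm
        _ ≤ Real.sqrt m := Real.sqrt_le_sqrt h1
    have hs5 : 5 ≤ Real.sqrt (m : ℝ) := by linarith
    have hlog_sqrt : Real.log m ≤ 2 * Real.sqrt m := by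
      have h := Real.log_le_sub_one_of_pos hs0
      rw [Real.log_sqrt hm0.le] at h
      linarith
    have hJhalf : (J : ℝ) ≤ m / 2 := by
      have h1 : (J : ℝ) ≤ 2 * Real.sqrt m / lam + 1 := by
        have := div_le_div_of_nonneg_right hlog_sqrt hlam0.le
        linarith
      have h2 : Real.sqrt m * (4 / lam + 1) ≤ Real.sqrt m * Real.sqrt m :=
        mul_le_mul_of_nonneg_left hsm hs0.le
      rw [hsq] at h2
      have h3 : 2 * Real.sqrt ↑m / lam = Real.sqrt m * (4 / lam) / 2 := by ring
      rw [h3] at h1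
      linarith
    have hJm : J ≤ m := by
      have : (J : ℝ) ≤ m := hJhalf.trans (by linarith)
      exact_mod_cast this
    have hρJ : ρ ^ J ≤ 1 / m := by
      have h1 : Real.log (ρ ^ J) ≤ -Real.log m := by
        rw [Real.log_pow]
        have : Real.log m ≤ J * lam := by rw [← div_le_iff₀ hlam0]; exact hJlo
        rw [hlam] at this
        linarith
      calc ρ ^ J = Real.exp (Real.log (ρ ^ J)) := (Real.exp_log (pow_pos hρ0 J)).symm
        _ ≤ Real.exp (-Real.log m) := Real.exp_le_exp.2 h1
        _ = 1 / m := by rw [Real.exp_neg, Real.exp_log hm0, one_div]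
    have hX : (b / 2) * m ≤ b * ((m + 1 - J : ℕ) : ℝ) := by
      have e : ((m + 1 - J : ℕ) : ℝ) = (m : ℝ) + 1 - J := by
        rw [Nat.cast_sub (hJm.trans (Nat.le_succ m))]; push_cast; ring
      rw [e]
      have := mul_le_mul_of_nonneg_left hJhalf hb.le
      linarith
    have hP : 2 * C₁ * J / Real.sqrt (b * ((m + 1 - J : ℕ) : ℝ)) ≤
        2 * C₁ * (Real.log m / lam + 1) / (Real.sqrt (b / 2) * Real.sqrt m) := by
      have h1 : Real.sqrt (b / 2) * Real.sqrt m ≤ Real.sqrt (b * ((m + 1 - J : ℕ) : ℝ)) := by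
        rw [← Real.sqrt_mul (by positivity : (0 : ℝ) ≤ b / 2)]
        exact Real.sqrt_le_sqrt hX
      have hden : 0 < Real.sqrt (b / 2) * Real.sqrt m := mul_pos hsb2 hs0
      calc 2 * C₁ * J / Real.sqrt (b * ((m + 1 - J : ℕ) : ℝ))
          ≤ 2 * C₁ * J / (Real.sqrt (b / 2) * Real.sqrt m) := div_le_div_of_nonneg_left (by positivity) hden h1
        _ ≤ 2 * C₁ * (Real.log m / lam + 1) / (Real.sqrt (b / 2) * Real.sqrt m) :=
            div_le_div_of_nonneg_right (mul_le_mul_of_nonneg_left hJhi.le (by positivity)) hden.le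
    have hG : A₀ * ρ ^ J ≤ A₀ * (1 / Real.sqrt m) := by
      refine mul_le_mul_of_nonneg_left (hρJ.trans ?_) hA₀0
      have hsle : Real.sqrt (m : ℝ) ≤ m := by
        calc Real.sqrt (m : ℝ) = Real.sqrt m * 1 := (mul_one _).symm
          _ ≤ Real.sqrt m * Real.sqrt m := mul_le_mul_of_nonneg_left (by linarith) hs0.le
          _ = m := hsq
      exact one_div_le_one_div_of_le hs0 hsle
    have hunit : 1 / Real.sqrt (m : ℝ) ≤ 1 / Real.log 2 * (Real.log m / Real.sqrt m) := by
      have h1 : 1 ≤ Real.log m / Real.log 2 := (one_le_div hlog2).2 hlogm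
      have h2 : 1 / Real.sqrt (m : ℝ) * 1 ≤ 1 / Real.sqrt m * (Real.log m / Real.log 2) :=
        mul_le_mul_of_nonneg_left h1 (by positivity)
      calc 1 / Real.sqrt (m : ℝ) = 1 / Real.sqrt m * 1 := (mul_one _).symm
        _ ≤ 1 / Real.sqrt m * (Real.log m / Real.log 2) := h2
        _ = 1 / Real.log 2 * (Real.log m / Real.sqrt m) := by ring
    have hK0 : 0 ≤ 2 * C₁ / Real.sqrt (b / 2) := by positivity
    have hsplitP : 2 * C₁ * (Real.log m / lam + 1) / (Real.sqrt (b / 2) * Real.sqrt m) =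
        2 * C₁ / Real.sqrt (b / 2) * (1 / lam) * (Real.log m / Real.sqrt m) +
          2 * C₁ / Real.sqrt (b / 2) * (1 / Real.sqrt m) := by
      ring
    have hq1 := mul_le_mul_of_nonneg_left hunit hK0
    have hq2 := mul_le_mul_of_nonneg_left hunit hA₀0
    calc |invSq G m j - astar G m - uvDefect S binf j|
        ≤ 2 * C₁ * J / Real.sqrt (b * ((m + 1 - J : ℕ) : ℝ)) + A₀ * ρ ^ J := key J hJm
      _ ≤ 2 * C₁ * (Real.log m / lam + 1) / (Real.sqrt (b / 2) * Real.sqrt m) + A₀ * (1 / Real.sqrt m) :=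
          add_le_add hP hG
      _ = 2 * C₁ / Real.sqrt (b / 2) * (1 / lam) * (Real.log m / Real.sqrt m) +
            2 * C₁ / Real.sqrt (b / 2) * (1 / Real.sqrt m) + A₀ * (1 / Real.sqrt m) := by rw [hsplitP]
      _ ≤ 2 * C₁ / Real.sqrt (b / 2) * (1 / lam) * (Real.log m / Real.sqrt m) +
            2 * C₁ / Real.sqrt (b / 2) * (1 / Real.log 2 * (Real.log m / Real.sqrt m)) +
              A₀ * (1 / Real.log 2 * (Real.log m / Real.sqrt m)) := by linarith
      _ = Abig * (Real.log m / Real.sqrt m) := by rw [hAbig]; ring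
      _ ≤ (Abig + Asmall) * (Real.log m / Real.sqrt m) := by rw [add_mul]; linarith
  · -- SMALL m (2 ≤ m < M₀): the cut J = m
    have h := key m le_rfl
    have e : ((m + 1 - m : ℕ) : ℝ) = 1 := by rw [Nat.add_sub_cancel_left]; simp
    rw [e, mul_one] at h
    have hmM₀ : (m : ℝ) ≤ M₀ := by exact_mod_cast hmM.le
    have hρm : ρ ^ m ≤ 1 := pow_le_one₀ hρ0.le hρ1.le
    -- |…| ≤ 2C₁m/√b + A₀ ≤ 2C₁M₀/√b + A₀ =: B
    have hB : |invSq G m j - astar G m - uvDefect S binf j| ≤ 2 * C₁ * M₀ / Real.sqrt b + A₀ := by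
      have h1 : 2 * C₁ * (m : ℝ) / Real.sqrt b ≤ 2 * C₁ * M₀ / Real.sqrt b :=
        div_le_div_of_nonneg_right (mul_le_mul_of_nonneg_left hmM₀ (by positivity)) hsb.le
      have h2 : A₀ * ρ ^ m ≤ A₀ := by
        calc A₀ * ρ ^ m ≤ A₀ * 1 := mul_le_mul_of_nonneg_left hρm hA₀0
          _ = A₀ := mul_one _
      linarith
    -- log m/√m ≥ log 2/√M₀ on [2, M₀]
    have hlow : Real.log 2 / Real.sqrt M₀ ≤ Real.log m / Real.sqrt m := by
      have hsmM : Real.sqrt (m : ℝ) ≤ Real.sqrt M₀ := Real.sqrt_le_sqrt hmM₀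
      calc Real.log 2 / Real.sqrt M₀ ≤ Real.log m / Real.sqrt M₀ := div_le_div_of_nonneg_right hlogm hsM₀.le
        _ ≤ Real.log m / Real.sqrt m := div_le_div_of_nonneg_left hlogm0 hs0 hsmM
    have hone : (1 : ℝ) ≤ Real.sqrt M₀ / Real.log 2 * (Real.log m / Real.sqrt m) := by
      have h1 := mul_le_mul_of_nonneg_left hlow (by positivity : (0 : ℝ) ≤ Real.sqrt M₀ / Real.log 2)
      have e1 : Real.sqrt M₀ / Real.log 2 * (Real.log 2 / Real.sqrt M₀) = 1 := by
        field_simp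
      linarith [h1, e1]
    calc |invSq G m j - astar G m - uvDefect S binf j|
        ≤ (2 * C₁ * M₀ / Real.sqrt b + A₀) * 1 := by rw [mul_one]; exact hB
      _ ≤ (2 * C₁ * M₀ / Real.sqrt b + A₀) * (Real.sqrt M₀ / Real.log 2 * (Real.log m / Real.sqrt m)) :=
          mul_le_mul_of_nonneg_left hone hB0
      _ = Asmall * (Real.log m / Real.sqrt m) := by rw [hAsmall]; ring
      _ ≤ (Abig + Asmall) * (Real.log m / Real.sqrt m) := by rw [add_mul]; linarith

/-- **THE WHOLE TRAJECTORY** (v1.1; `k₀ ≤ i ≤ K − 2`).  Every lattice trajectory tracks the `δ`-shifted continuum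
trajectory with an error depending only on the DISTANCE TO THE PIN — one constant for every pinned family, every pin and
every run: `|1/g_K(i)² − a⋆_{K−i} − δ_i| ≤ A·log(K−i)/√(K−i)` (`abs_invSq_sub_astar_sub_uvDefect_le_unif` reindexed,
`m = K − i`). [folklore] -/
theorem abs_run_sub_astar_sub_uvDefect_le_unif (S : B12Beta.OneLoopSplit β) (hθ1 : θ < 1) (hb : 0 < b)
    (hlo : EventualLowerH b γ k₀ β) (hC₁ : 0 ≤ C₁)
    (hAF1 : ∀ k (p : Fin (k + 1) → ℝ), p ∈ Box γ k → |S.β1 k p| ≤ C₁ * p (Fin.last k))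
    (hθ₀0 : 0 ≤ θ₀) (hθ₀1 : θ₀ < 1) (hrate : ∀ k, |S.β0 k - binf| ≤ c₀ * θ₀ ^ k) :
    ∃ A : ℝ, 0 ≤ A ∧ ∀ (G : ℕ → ℕ → ℝ) (gir : ℝ), InjectedRate C 0 θ (fun K j => disc (G K) (G (K + 1)) j) →
      (∀ K, RGEqH K β (G K)) → (∀ K i, i ≤ K → 0 < G K i ∧ G K i ≤ γ) → (∀ K, G K K = gir) →
      ∀ ⦃K i : ℕ⦄, k₀ ≤ i → i + 2 ≤ K →
        |1 / (G K i) ^ 2 - astar G (K - i) - uvDefect S binf i| ≤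
          A * (Real.log ((K - i : ℕ) : ℝ) / Real.sqrt ((K - i : ℕ) : ℝ)) := by
  obtain ⟨A, hA0, hA⟩ := abs_invSq_sub_astar_sub_uvDefect_le_unif S hθ1 hb hlo hC₁ hAF1 hθ₀0 hθ₀1 hrate
  refine ⟨A, hA0, ?_⟩
  intro G gir hinj hrun hbox hpin K i hk₀ hiK
  have h := hA G gir hinj hrun hbox hpin hk₀ (m := K - i) (by omega)
  have e : i + (K - i) = K := by omega
  have e2 : invSq G (K - i) i = 1 / (G K i) ^ 2 := by unfold invSq; rw [e]
  rw [e2] at h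
  exact h

/-- **THE `O(log m/√m)` LAW OF THE MATCHING** (`k₀ ≤ j`; no sign assumption on `θ` — an injected rate may be taken with
the ratio `max θ 0`, `injectedRate_max_zero`): `1/g_{j+m}(j)² − a⋆_m − δ_j = O(log m/√m)` as `m → ∞` — the two-piece
rate with the cut `J = ⌈log m/log(1/ρ)⌉`, `ρ := max(θ, θ₀, 1/2)`, where the geometric piece is `≤ A/m` and the profile
piece `≤ 2√2·C₁(log m/log(1/ρ) + 1)/√(bm)`.  The constant is explicit in the proof; the rate is that of the PROFILE
piece and is not claimed optimal. [folklore] -/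
theorem isBigO_invSq_sub_astar_sub_uvDefect (S : B12Beta.OneLoopSplit β) (hθ1 : θ < 1)
    (hinj : InjectedRate C 0 θ (fun K j => disc (g K) (g (K + 1)) j)) (hrun : ∀ K, RGEqH K β (g K))
    (hbox : ∀ K i, i ≤ K → 0 < g K i ∧ g K i ≤ γ) (hpin : ∀ K, g K K = gIR)
    (hb : 0 < b) (hlo : EventualLowerH b γ k₀ β) (hC₁ : 0 ≤ C₁)
    (hAF1 : ∀ k (p : Fin (k + 1) → ℝ), p ∈ Box γ k → |S.β1 k p| ≤ C₁ * p (Fin.last k))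
    (hθ₀0 : 0 ≤ θ₀) (hθ₀1 : θ₀ < 1) (hrate : ∀ k, |S.β0 k - binf| ≤ c₀ * θ₀ ^ k) {j : ℕ} (hk₀ : k₀ ≤ j) :
    (fun m : ℕ => invSq g m j - astar g m - uvDefect S binf j) =O[atTop]
      (fun m : ℕ => Real.log (m : ℝ) / Real.sqrt (m : ℝ)) := by
  obtain ⟨A, -, hA⟩ := abs_invSq_sub_astar_sub_uvDefect_le_unif S hθ1 hb hlo hC₁ hAF1 hθ₀0 hθ₀1 hrate
  refine IsBigO.of_bound A ?_
  filter_upwards [eventually_ge_atTop 2] with m hm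
  have hmr : (2 : ℝ) ≤ m := by exact_mod_cast hm
  have hu0 : 0 ≤ Real.log m / Real.sqrt m :=
    div_nonneg ((Real.log_pos one_lt_two).le.trans (Real.log_le_log two_pos hmr)) (Real.sqrt_nonneg _)
  rw [Real.norm_eq_abs, Real.norm_eq_abs, abs_of_nonneg hu0]
  exact hA g gIR hinj hrun hbox hpin hk₀ hm

/-- THE BARE END WITH RATE (`k₀ = 0`, i.e. the lower bound `b ≤ β` on ALL boxes — `FlowStep.BetaLowerH`): the bare
matching `1/g_K(0)² − a⋆_K − δ₀ = O(log K/√K)`. [folklore] -/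
theorem isBigO_bare_sub_astar_sub_oneLoopDefect (S : B12Beta.OneLoopSplit β) (hθ1 : θ < 1)
    (hinj : InjectedRate C 0 θ (fun K j => disc (g K) (g (K + 1)) j)) (hrun : ∀ K, RGEqH K β (g K))
    (hbox : ∀ K i, i ≤ K → 0 < g K i ∧ g K i ≤ γ) (hpin : ∀ K, g K K = gIR)
    (hb : 0 < b) (hlo : BetaLowerH b γ β) (hC₁ : 0 ≤ C₁)
    (hAF1 : ∀ k (p : Fin (k + 1) → ℝ), p ∈ Box γ k → |S.β1 k p| ≤ C₁ * p (Fin.last k))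
    (hθ₀0 : 0 ≤ θ₀) (hθ₀1 : θ₀ < 1) (hrate : ∀ k, |S.β0 k - binf| ≤ c₀ * θ₀ ^ k) :
    (fun K : ℕ => 1 / (g K 0) ^ 2 - astar g K - oneLoopDefect S binf) =O[atTop]
      (fun K : ℕ => Real.log (K : ℝ) / Real.sqrt (K : ℝ)) := by
  have h := isBigO_invSq_sub_astar_sub_uvDefect S hθ1 hinj hrun hbox hpin hb (eventualLowerH_of_betaLowerH hlo 0)
    hC₁ hAF1 hθ₀0 hθ₀1 hrate (j := 0) le_rfl
  rw [uvDefect_zero] at h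
  exact h.congr_left fun K => by simp [invSq]

/-- `log(m+1)/√(m+1) ≤ 2·log m/√m` for `m ≥ 2` (so the comparison scale is stable under the unit shift). [folklore] -/
theorem log_succ_div_sqrt_le {m : ℕ} (hm : 2 ≤ m) :
    Real.log ((m : ℝ) + 1) / Real.sqrt ((m : ℝ) + 1) ≤ 2 * (Real.log m / Real.sqrt m) := by
  have hmr : (2 : ℝ) ≤ m := by exact_mod_cast hm
  have hm0 : (0 : ℝ) < m := by linarith
  have hlog2 : 0 < Real.log 2 := Real.log_pos one_lt_two
  have hlogm : Real.log 2 ≤ Real.log m := Real.log_le_log two_pos hmr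
  have hs0 : 0 < Real.sqrt (m : ℝ) := Real.sqrt_pos.2 hm0
  have h1 : Real.log ((m : ℝ) + 1) ≤ 2 * Real.log m := by
    calc Real.log ((m : ℝ) + 1) ≤ Real.log (2 * m) := Real.log_le_log (by linarith) (by linarith)
      _ = Real.log 2 + Real.log m := Real.log_mul (by norm_num) hm0.ne'
      _ ≤ 2 * Real.log m := by linarith
  have h2 : Real.sqrt (m : ℝ) ≤ Real.sqrt ((m : ℝ) + 1) := Real.sqrt_le_sqrt (by linarith)
  have h3 : 0 ≤ Real.log ((m : ℝ) + 1) := Real.log_nonneg (by linarith)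
  calc Real.log ((m : ℝ) + 1) / Real.sqrt ((m : ℝ) + 1)
      ≤ Real.log ((m : ℝ) + 1) / Real.sqrt m := div_le_div_of_nonneg_left h3 hs0 h2
    _ ≤ 2 * Real.log m / Real.sqrt m := div_le_div_of_nonneg_right h1 hs0.le
    _ = 2 * (Real.log m / Real.sqrt m) := by ring

/-- The continuum scale step against its limit with the profile constant (v1.1): for `m ≥ 1`,
`|b⋆_m − β⁰_∞| ≤ C₁/(√b·√m)` (`T4ContinuumCoupling.abs_bstar_sub_binf_le`: `≤ C₁·g⋆_{m+1}`, and
`g⋆_{m+1} ≤ 1/s_{m+1} ≤ 1/√(bm)`, `gstar_le_inv_sprof`); the constant involves neither `γ` nor `g_IR`. [folklore] -/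
theorem abs_bstar_sub_binf_le_inv_sqrt (S : B12Beta.OneLoopSplit β) (hθ1 : θ < 1)
    (hinj : InjectedRate C 0 θ (fun K j => disc (g K) (g (K + 1)) j)) (hrun : ∀ K, RGEqH K β (g K))
    (hbox : ∀ K i, i ≤ K → 0 < g K i ∧ g K i ≤ γ) (hpin : ∀ K, g K K = gIR)
    (hb : 0 < b) (hlo : EventualLowerH b γ k₀ β) (hC₁ : 0 ≤ C₁)
    (hAF1 : ∀ k (p : Fin (k + 1) → ℝ), p ∈ Box γ k → |S.β1 k p| ≤ C₁ * p (Fin.last k))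
    (hθ₀0 : 0 ≤ θ₀) (hθ₀1 : θ₀ < 1) (hrate : ∀ k, |S.β0 k - binf| ≤ c₀ * θ₀ ^ k) {m : ℕ} (hm : 1 ≤ m) :
    |bstar g m - binf| ≤ C₁ / (Real.sqrt b * Real.sqrt m) := by
  have hconv : Tendsto S.β0 atTop (𝓝 binf) := tendsto_of_abs_sub_le_geom hθ₀0 hθ₀1 hrate
  have hmr : (1 : ℝ) ≤ m := by exact_mod_cast hm
  have hm0 : (0 : ℝ) < m := by linarith
  have hs0 : 0 < Real.sqrt (m : ℝ) := Real.sqrt_pos.2 hm0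
  have hsb : 0 < Real.sqrt b := Real.sqrt_pos.2 hb
  have h1 := abs_bstar_sub_binf_le S hθ1 hinj hrun hbox hconv hAF1 m
  have h2 := gstar_le_inv_sprof hθ1 hinj hrun hbox hpin hlo hb.le (m + 1)
  have h3 : Real.sqrt b * Real.sqrt m ≤ sprof gIR b (m + 1) := by
    rw [← Real.sqrt_mul hb.le]
    unfold sprof prof
    refine Real.sqrt_le_sqrt ?_
    have : 0 ≤ 1 / gIR ^ 2 := by positivity
    push_cast
    nlinarith
  have h4 : gstar g (m + 1) ≤ 1 / (Real.sqrt b * Real.sqrt m) :=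
    h2.trans (div_le_div_of_nonneg_left zero_le_one (mul_pos hsb hs0) h3)
  calc |bstar g m - binf| ≤ C₁ * gstar g (m + 1) := h1
    _ ≤ C₁ * (1 / (Real.sqrt b * Real.sqrt m)) := mul_le_mul_of_nonneg_left h4 hC₁
    _ = C₁ / (Real.sqrt b * Real.sqrt m) := mul_one_div _ _

/-- The continuum scale step has the profile rate: `b⋆_m − b_∞ = O(log m/√m)` (indeed `O(1/√m)`:
`|b⋆_m − b_∞| ≤ C₁·g⋆_{m+1} ≤ C₁/√(bm)`, `T4ContinuumCoupling.abs_bstar_sub_binf_le` + `gstar_le_inv_sprof`). [folklore] -/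
theorem isBigO_bstar_sub (S : B12Beta.OneLoopSplit β) (hθ1 : θ < 1)
    (hinj : InjectedRate C 0 θ (fun K j => disc (g K) (g (K + 1)) j)) (hrun : ∀ K, RGEqH K β (g K))
    (hbox : ∀ K i, i ≤ K → 0 < g K i ∧ g K i ≤ γ) (hpin : ∀ K, g K K = gIR)
    (hb : 0 < b) (hlo : EventualLowerH b γ k₀ β) (hC₁ : 0 ≤ C₁)
    (hAF1 : ∀ k (p : Fin (k + 1) → ℝ), p ∈ Box γ k → |S.β1 k p| ≤ C₁ * p (Fin.last k))
    (hθ₀0 : 0 ≤ θ₀) (hθ₀1 : θ₀ < 1) (hrate : ∀ k, |S.β0 k - binf| ≤ c₀ * θ₀ ^ k) :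
    (fun m : ℕ => bstar g m - binf) =O[atTop] (fun m : ℕ => Real.log (m : ℝ) / Real.sqrt (m : ℝ)) := by
  have hlog2 : 0 < Real.log 2 := Real.log_pos one_lt_two
  have hsb : 0 < Real.sqrt b := Real.sqrt_pos.2 hb
  refine IsBigO.of_bound (C₁ / Real.sqrt b * (1 / Real.log 2)) ?_
  filter_upwards [eventually_ge_atTop 2] with m hm
  have hmr : (2 : ℝ) ≤ m := by exact_mod_cast hm
  have hm0 : (0 : ℝ) < m := by linarith
  have hlogm : Real.log 2 ≤ Real.log m := Real.log_le_log two_pos hmr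
  have hlogm0 : 0 ≤ Real.log m := hlog2.le.trans hlogm
  have hs0 : 0 < Real.sqrt (m : ℝ) := Real.sqrt_pos.2 hm0
  have hu0 : 0 ≤ Real.log m / Real.sqrt m := div_nonneg hlogm0 hs0.le
  rw [Real.norm_eq_abs, Real.norm_eq_abs, abs_of_nonneg hu0]
  have h5 : 1 / Real.sqrt (m : ℝ) ≤ 1 / Real.log 2 * (Real.log m / Real.sqrt m) := by
    have e1 : 1 ≤ Real.log m / Real.log 2 := (one_le_div hlog2).2 hlogm
    have e2 : 1 / Real.sqrt (m : ℝ) * 1 ≤ 1 / Real.sqrt m * (Real.log m / Real.log 2) :=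
      mul_le_mul_of_nonneg_left e1 (by positivity)
    calc 1 / Real.sqrt (m : ℝ) = 1 / Real.sqrt m * 1 := (mul_one _).symm
      _ ≤ 1 / Real.sqrt m * (Real.log m / Real.log 2) := e2
      _ = 1 / Real.log 2 * (Real.log m / Real.sqrt m) := by ring
  have h6 := mul_le_mul_of_nonneg_left h5 (div_nonneg hC₁ hsb.le)
  calc |bstar g m - binf| ≤ C₁ / (Real.sqrt b * Real.sqrt m) :=
        abs_bstar_sub_binf_le_inv_sqrt S hθ1 hinj hrun hbox hpin hb hlo hC₁ hAF1 hθ₀0 hθ₀1 hrate (by omega)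
    _ = C₁ / Real.sqrt b * (1 / Real.sqrt m) := by rw [mul_one_div, div_div]
    _ ≤ C₁ / Real.sqrt b * (1 / Real.log 2 * (Real.log m / Real.sqrt m)) := h6
    _ = C₁ / Real.sqrt b * (1 / Real.log 2) * (Real.log m / Real.sqrt m) := by ring

/-- **THE TWO-TRAJECTORY SCALE STEP WITH RATE** (`k₀ ≤ j`): at a fixed ultraviolet index the couplings of the two
pinned lattice trajectories with `K+1` and `K` steps match to one continuum scale step up to the profile rate,
`1/g_{j+m+1}(j)² − 1/g_{j+m}(j)² = b_∞ + O(log m/√m)` — `isBigO_invSq_sub_astar_sub_uvDefect` at `m+1`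
(`log_succ_div_sqrt_le`) and at `m`, plus `isBigO_bstar_sub`. [folklore] -/
theorem isBigO_twoRun_step (S : B12Beta.OneLoopSplit β) (hθ1 : θ < 1)
    (hinj : InjectedRate C 0 θ (fun K j => disc (g K) (g (K + 1)) j)) (hrun : ∀ K, RGEqH K β (g K))
    (hbox : ∀ K i, i ≤ K → 0 < g K i ∧ g K i ≤ γ) (hpin : ∀ K, g K K = gIR)
    (hb : 0 < b) (hlo : EventualLowerH b γ k₀ β) (hC₁ : 0 ≤ C₁)
    (hAF1 : ∀ k (p : Fin (k + 1) → ℝ), p ∈ Box γ k → |S.β1 k p| ≤ C₁ * p (Fin.last k))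
    (hθ₀0 : 0 ≤ θ₀) (hθ₀1 : θ₀ < 1) (hrate : ∀ k, |S.β0 k - binf| ≤ c₀ * θ₀ ^ k) {j : ℕ} (hk₀ : k₀ ≤ j) :
    (fun m : ℕ => invSq g (m + 1) j - invSq g m j - binf) =O[atTop]
      (fun m : ℕ => Real.log (m : ℝ) / Real.sqrt (m : ℝ)) := by
  have hF := isBigO_invSq_sub_astar_sub_uvDefect S hθ1 hinj hrun hbox hpin hb hlo hC₁ hAF1 hθ₀0 hθ₀1 hrate hk₀
  have hB := isBigO_bstar_sub S hθ1 hinj hrun hbox hpin hb hlo hC₁ hAF1 hθ₀0 hθ₀1 hrate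
  have hu1 : ((fun m : ℕ => Real.log (m : ℝ) / Real.sqrt (m : ℝ)) ∘ fun a => a + 1) =O[atTop]
      (fun m : ℕ => Real.log (m : ℝ) / Real.sqrt (m : ℝ)) := by
    refine IsBigO.of_bound 2 ?_
    filter_upwards [eventually_ge_atTop 2] with m hm
    have hmr : (2 : ℝ) ≤ m := by exact_mod_cast hm
    have hu0 : 0 ≤ Real.log m / Real.sqrt m :=
      div_nonneg ((Real.log_pos one_lt_two).le.trans (Real.log_le_log two_pos hmr)) (Real.sqrt_nonneg _)
    have hv0 : 0 ≤ Real.log ((m : ℝ) + 1) / Real.sqrt ((m : ℝ) + 1) :=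
      div_nonneg (Real.log_nonneg (by linarith)) (Real.sqrt_nonneg _)
    simp only [Function.comp, Nat.cast_add, Nat.cast_one, Real.norm_eq_abs]
    rw [abs_of_nonneg hv0, abs_of_nonneg hu0]
    exact log_succ_div_sqrt_le hm
  have hF1 := (hF.comp_tendsto (tendsto_add_atTop_nat 1)).trans hu1
  have h := (hF1.sub hF).add hB
  refine h.congr_left fun m => ?_
  simp only [Function.comp, bstar]
  ring

/-- **UNIFORMITY OF THE TWO-TRAJECTORY SCALE STEP** (v1.1).  ONE constant for every pinned family, every pin, every
ultraviolet index `j ≥ k₀` and every distance `m ≥ 2`: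
`|1/g_{j+m+1}(j)² − 1/g_{j+m}(j)² − β⁰_∞| ≤ A′·log m/√m`, `A′ = 3A + C₁/(√b·log 2)` with the `A` of
`abs_invSq_sub_astar_sub_uvDefect_le_unif` (at `m+1` via `log_succ_div_sqrt_le`, at `m`, plus
`abs_bstar_sub_binf_le_inv_sqrt`). [folklore] -/
theorem abs_twoRun_step_sub_le_unif (S : B12Beta.OneLoopSplit β) (hθ1 : θ < 1) (hb : 0 < b)
    (hlo : EventualLowerH b γ k₀ β) (hC₁ : 0 ≤ C₁)
    (hAF1 : ∀ k (p : Fin (k + 1) → ℝ), p ∈ Box γ k → |S.β1 k p| ≤ C₁ * p (Fin.last k))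
    (hθ₀0 : 0 ≤ θ₀) (hθ₀1 : θ₀ < 1) (hrate : ∀ k, |S.β0 k - binf| ≤ c₀ * θ₀ ^ k) :
    ∃ A : ℝ, 0 ≤ A ∧ ∀ (G : ℕ → ℕ → ℝ) (gir : ℝ), InjectedRate C 0 θ (fun K j => disc (G K) (G (K + 1)) j) →
      (∀ K, RGEqH K β (G K)) → (∀ K i, i ≤ K → 0 < G K i ∧ G K i ≤ γ) → (∀ K, G K K = gir) →
      ∀ ⦃j : ℕ⦄, k₀ ≤ j → ∀ ⦃m : ℕ⦄, 2 ≤ m →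
        |invSq G (m + 1) j - invSq G m j - binf| ≤ A * (Real.log m / Real.sqrt m) := by
  obtain ⟨A, hA0, hA⟩ := abs_invSq_sub_astar_sub_uvDefect_le_unif S hθ1 hb hlo hC₁ hAF1 hθ₀0 hθ₀1 hrate
  have hlog2 : 0 < Real.log 2 := Real.log_pos one_lt_two
  have hsb : 0 < Real.sqrt b := Real.sqrt_pos.2 hb
  refine ⟨3 * A + C₁ / Real.sqrt b * (1 / Real.log 2), by positivity, ?_⟩
  intro G gir hinj hrun hbox hpin j hk₀ m hm2
  have hmr : (2 : ℝ) ≤ m := by exact_mod_cast hm2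
  have hm0 : (0 : ℝ) < m := by linarith
  have hlogm : Real.log 2 ≤ Real.log m := Real.log_le_log two_pos hmr
  have hlogm0 : 0 ≤ Real.log m := hlog2.le.trans hlogm
  have hs0 : 0 < Real.sqrt (m : ℝ) := Real.sqrt_pos.2 hm0
  have hu0 : 0 ≤ Real.log m / Real.sqrt m := div_nonneg hlogm0 hs0.le
  have hF0 := hA G gir hinj hrun hbox hpin hk₀ hm2
  have hF1 := hA G gir hinj hrun hbox hpin hk₀ (m := m + 1) (by omega)
  have hB := abs_bstar_sub_binf_le_inv_sqrt S hθ1 hinj hrun hbox hpin hb hlo hC₁ hAF1 hθ₀0 hθ₀1 hrate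
    (m := m) (by omega)
  have hsucc : Real.log ((m + 1 : ℕ) : ℝ) / Real.sqrt ((m + 1 : ℕ) : ℝ) ≤ 2 * (Real.log m / Real.sqrt m) := by
    push_cast; exact log_succ_div_sqrt_le hm2
  have hF1' : |invSq G (m + 1) j - astar G (m + 1) - uvDefect S binf j| ≤ 2 * A * (Real.log m / Real.sqrt m) := by
    refine hF1.trans ?_
    have := mul_le_mul_of_nonneg_left hsucc hA0
    linarith
  have h5 : 1 / Real.sqrt (m : ℝ) ≤ 1 / Real.log 2 * (Real.log m / Real.sqrt m) := by
    have e1 : 1 ≤ Real.log m / Real.log 2 := (one_le_div hlog2).2 hlogm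
    have e2 : 1 / Real.sqrt (m : ℝ) * 1 ≤ 1 / Real.sqrt m * (Real.log m / Real.log 2) :=
      mul_le_mul_of_nonneg_left e1 (by positivity)
    calc 1 / Real.sqrt (m : ℝ) = 1 / Real.sqrt m * 1 := (mul_one _).symm
      _ ≤ 1 / Real.sqrt m * (Real.log m / Real.log 2) := e2
      _ = 1 / Real.log 2 * (Real.log m / Real.sqrt m) := by ring
  have hB' : |bstar G m - binf| ≤ C₁ / Real.sqrt b * (1 / Real.log 2) * (Real.log m / Real.sqrt m) := by
    have h6 := mul_le_mul_of_nonneg_left h5 (div_nonneg hC₁ hsb.le)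
    calc |bstar G m - binf| ≤ C₁ / (Real.sqrt b * Real.sqrt m) := hB
      _ = C₁ / Real.sqrt b * (1 / Real.sqrt m) := by rw [mul_one_div, div_div]
      _ ≤ C₁ / Real.sqrt b * (1 / Real.log 2 * (Real.log m / Real.sqrt m)) := h6
      _ = C₁ / Real.sqrt b * (1 / Real.log 2) * (Real.log m / Real.sqrt m) := by ring
  have e : invSq G (m + 1) j - invSq G m j - binf =
      (invSq G (m + 1) j - astar G (m + 1) - uvDefect S binf j) -
        (invSq G m j - astar G m - uvDefect S binf j) + (bstar G m - binf) := by
    simp only [bstar]; ring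
  rw [e]
  calc |invSq G (m + 1) j - astar G (m + 1) - uvDefect S binf j -
          (invSq G m j - astar G m - uvDefect S binf j) + (bstar G m - binf)|
      ≤ |invSq G (m + 1) j - astar G (m + 1) - uvDefect S binf j -
          (invSq G m j - astar G m - uvDefect S binf j)| + |bstar G m - binf| := abs_add_le _ _
    _ ≤ |invSq G (m + 1) j - astar G (m + 1) - uvDefect S binf j| +
          |invSq G m j - astar G m - uvDefect S binf j| + |bstar G m - binf| :=
        add_le_add (abs_sub _ _) le_rfl
    _ ≤ 2 * A * (Real.log m / Real.sqrt m) + A * (Real.log m / Real.sqrt m) +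
          C₁ / Real.sqrt b * (1 / Real.log 2) * (Real.log m / Real.sqrt m) :=
        add_le_add (add_le_add hF1' hF0) hB'
    _ = (3 * A + C₁ / Real.sqrt b * (1 / Real.log 2)) * (Real.log m / Real.sqrt m) := by ring

end Matching

/-! ## §6 Sanity: the two-loop Markov family -/

section Markov

/-- SANITY (non-vacuity): for the two-loop MARKOV family `β_{k+1}(g_0,…,g_k) = b + c·g_k²` (`b > 0`, `c ≥ 0`,
`2cγ(γ³ + 2γ/b) < 1/2`; unique box continuation `T4ContinuumTwoLoopLaw.backwardWP_twoLoopMarkov`) every binder of §4–§5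
holds for the pinned family (`pinnedRun`) of every datum `g_IR ∈ ]0,γ]` — β⁰ ≡ b ((AF-0r) with `c₀ = 0`), (AF-1) with
`C₁ = cγ`, `InjectedRate 0 0 0` by scale-shift invariance (`injectedRate_pinnedRun`), `k₀ = 0` — the one-loop defects
`δ_j` VANISH, and so at every ultraviolet index the lattice recursion variable converges to the continuum one,
`1/g_{j+m}(j)² − a⋆_m → 0`, at the rate `O(log m/√m)`, and the two-trajectory scale step tends to `b`:
`1/g_{j+m+1}(j)² − 1/g_{j+m}(j)² → b`. [folklore] -/
example {γ b c gIR : ℝ} (hγ : 0 < γ) (hb : 0 < b) (hc : 0 ≤ c)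
    (hsmall : 2 * c * γ * (γ ^ 3 + 2 * γ / b) < 1 / 2) (hgIR : 0 < gIR) (hgIRγ : gIR ≤ γ) (j : ℕ) :
    Tendsto (fun m => invSq (fun K => pinnedRun (fun k (p : Fin (k + 1) → ℝ) => b + c * p (Fin.last k) ^ 2) γ K gIR)
        m j - astar (fun K => pinnedRun (fun k (p : Fin (k + 1) → ℝ) => b + c * p (Fin.last k) ^ 2) γ K gIR) m)
      atTop (𝓝 0) ∧
    (fun m : ℕ => invSq (fun K => pinnedRun (fun k (p : Fin (k + 1) → ℝ) => b + c * p (Fin.last k) ^ 2) γ K gIR)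
        m j - astar (fun K => pinnedRun (fun k (p : Fin (k + 1) → ℝ) => b + c * p (Fin.last k) ^ 2) γ K gIR) m)
      =O[atTop] (fun m : ℕ => Real.log (m : ℝ) / Real.sqrt (m : ℝ)) ∧
    Tendsto (fun m => invSq (fun K => pinnedRun (fun k (p : Fin (k + 1) → ℝ) => b + c * p (Fin.last k) ^ 2) γ K gIR)
        (m + 1) j - invSq (fun K => pinnedRun (fun k (p : Fin (k + 1) → ℝ) => b + c * p (Fin.last k) ^ 2) γ K gIR)
        m j) atTop (𝓝 b) := by
  obtain ⟨q, H⟩ := backwardWP_twoLoopMarkov hγ hb hc hsmall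
  set β : HBeta := fun k p => b + c * p (Fin.last k) ^ 2 with hβ
  have hmk : ∀ k (p : Fin (k + 1) → ℝ), β k p = (fun x => b + c * x ^ 2) (p (Fin.last k)) := fun _ _ => rfl
  let S : B12Beta.OneLoopSplit β :=
    { β0 := fun _ => b
      β1 := fun k p => c * p (Fin.last k) ^ 2
      split := fun k p => rfl
      vanish := fun k p hp => by simp [hp] }
  have hAF1 : ∀ k (p : Fin (k + 1) → ℝ), p ∈ Box γ k → |S.β1 k p| ≤ c * γ * p (Fin.last k) := by
    intro k p hp
    have h := (mem_box.1 hp) (Fin.last k)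
    show |c * p (Fin.last k) ^ 2| ≤ c * γ * p (Fin.last k)
    rw [abs_of_nonneg (by positivity)]
    nlinarith [mul_nonneg hc h.1.le, h.2]
  have hrate : ∀ k, |S.β0 k - b| ≤ 0 * (0 : ℝ) ^ k := fun k => by simp [S]
  have hlo : EventualLowerH b γ 0 β := fun k v _ _ => le_add_of_nonneg_right (mul_nonneg hc (sq_nonneg _))
  have hrun : ∀ K, RGEqH K β (pinnedRun β γ K gIR) := fun K => (pinnedRun_spec H K hgIR hgIRγ).2.1
  have hbox : ∀ K i, i ≤ K → 0 < pinnedRun β γ K gIR i ∧ pinnedRun β γ K gIR i ≤ γ :=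
    fun K => (pinnedRun_spec H K hgIR hgIRγ).2.2
  have hpin : ∀ K, pinnedRun β γ K gIR K = gIR := fun K => (pinnedRun_spec H K hgIR hgIRγ).1
  have hinj : InjectedRate 0 0 0 (fun K j => disc (pinnedRun β γ K gIR) (pinnedRun β γ (K + 1) gIR) j) :=
    injectedRate_pinnedRun H (f := fun x => b + c * x ^ 2) hmk hgIR hgIRγ 0
  -- the one-loop defects vanish identically
  have hδ : uvDefect S b j = 0 := by simp [uvDefect, S]
  have h1 := tendsto_invSq_sub_astar S zero_lt_one hinj hrun hbox hpin hb hlo (by positivity) hAF1 le_rfl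
    zero_lt_one hrate j
  have h2 := isBigO_invSq_sub_astar_sub_uvDefect S zero_lt_one hinj hrun hbox hpin hb hlo (by positivity) hAF1
    le_rfl zero_lt_one hrate (j := j) (Nat.zero_le j)
  have h3 := tendsto_twoRun_step S zero_lt_one hinj hrun hbox hpin hb hlo (by positivity) hAF1 le_rfl zero_lt_one
    hrate j
  rw [hδ] at h1 h2
  exact ⟨h1, by simpa using h2, h3⟩

/-- SANITY FOR THE UNIFORMITY (v1.1): for the two-loop Markov family ONE constant serves every infrared datum
`g_IR ∈ ]0,γ]`, every ultraviolet index `j` and every distance `m ≥ 2` — the constant is produced BEFORE the datum is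
chosen (`abs_invSq_sub_astar_sub_uvDefect_le_unif` with `C = θ = c₀ = θ₀ = 0`, `C₁ = cγ`, `k₀ = 0`; `δ_j = 0`). [folklore] -/
example {γ b c : ℝ} (hγ : 0 < γ) (hb : 0 < b) (hc : 0 ≤ c) (hsmall : 2 * c * γ * (γ ^ 3 + 2 * γ / b) < 1 / 2) :
    ∃ A : ℝ, 0 ≤ A ∧ ∀ gIR : ℝ, 0 < gIR → gIR ≤ γ → ∀ j m : ℕ, 2 ≤ m →
      |invSq (fun K => pinnedRun (fun k (p : Fin (k + 1) → ℝ) => b + c * p (Fin.last k) ^ 2) γ K gIR) m j -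
          astar (fun K => pinnedRun (fun k (p : Fin (k + 1) → ℝ) => b + c * p (Fin.last k) ^ 2) γ K gIR) m| ≤
        A * (Real.log (m : ℝ) / Real.sqrt (m : ℝ)) := by
  obtain ⟨q, H⟩ := backwardWP_twoLoopMarkov hγ hb hc hsmall
  set β : HBeta := fun k p => b + c * p (Fin.last k) ^ 2 with hβ
  have hmk : ∀ k (p : Fin (k + 1) → ℝ), β k p = (fun x => b + c * x ^ 2) (p (Fin.last k)) := fun _ _ => rfl
  let S : B12Beta.OneLoopSplit β :=
    { β0 := fun _ => b
      β1 := fun k p => c * p (Fin.last k) ^ 2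
      split := fun k p => rfl
      vanish := fun k p hp => by simp [hp] }
  have hAF1 : ∀ k (p : Fin (k + 1) → ℝ), p ∈ Box γ k → |S.β1 k p| ≤ c * γ * p (Fin.last k) := by
    intro k p hp
    have h := (mem_box.1 hp) (Fin.last k)
    show |c * p (Fin.last k) ^ 2| ≤ c * γ * p (Fin.last k)
    rw [abs_of_nonneg (by positivity)]
    nlinarith [mul_nonneg hc h.1.le, h.2]
  have hrate : ∀ k, |S.β0 k - b| ≤ 0 * (0 : ℝ) ^ k := fun k => by simp [S]
  have hlo : EventualLowerH b γ 0 β := fun k v _ _ => le_add_of_nonneg_right (mul_nonneg hc (sq_nonneg _))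
  -- the constant, before the datum
  obtain ⟨A, hA0, hA⟩ := abs_invSq_sub_astar_sub_uvDefect_le_unif (C := 0) S zero_lt_one hb hlo (by positivity)
    hAF1 le_rfl zero_lt_one hrate
  refine ⟨A, hA0, fun gIR hgIR hgIRγ j m hm => ?_⟩
  have hrun : ∀ K, RGEqH K β (pinnedRun β γ K gIR) := fun K => (pinnedRun_spec H K hgIR hgIRγ).2.1
  have hbox : ∀ K i, i ≤ K → 0 < pinnedRun β γ K gIR i ∧ pinnedRun β γ K gIR i ≤ γ :=
    fun K => (pinnedRun_spec H K hgIR hgIRγ).2.2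
  have hpin : ∀ K, pinnedRun β γ K gIR K = gIR := fun K => (pinnedRun_spec H K hgIR hgIRγ).1
  have hinj : InjectedRate 0 0 0 (fun K j => disc (pinnedRun β γ K gIR) (pinnedRun β γ (K + 1) gIR) j) :=
    injectedRate_pinnedRun H (f := fun x => b + c * x ^ 2) hmk hgIR hgIRγ 0
  have hδ : uvDefect S b j = 0 := by simp [uvDefect, S]
  have h := hA _ gIR hinj hrun hbox hpin (Nat.zero_le j) hm
  rw [hδ, sub_zero] at h
  exact h

end Markov

end Literature.MathematicalPhysics.QuantumFieldTheory.Balaban1983to89.T4ScaleMatchingRate
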